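import Literature.NumberTheory.GaussSums.DeligneJacobiGaloisCharacter
import Literature.NumberTheory.ComplexMultiplication.ReflexNormIdeal
import HarnessLib

/-!
# Weil 1952, (8) «`(J_a(𝔞)) = 𝔞^{ω(a)}`», (10) «`|J_a(𝔞)|² = N𝔞^{s−2}`», (11) «`J_a(𝔞)^{σ_t} = J_{ta}(𝔞)`» and (12) «`ε(a) = J_a((α)) α^{−ω(a)}` is a unit … a root of unity» for every number `r` of exponents; the factorisation and weight of Deligne's `J_a(𝔞)`, `σ_t g(𝔞, a) = g(𝔞, ta)`, and `χ_{ta} = τ_t ∘ χ_a`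

Topic `Literature/NumberTheory/GaussSums`; sequel of `JacobiSumGrossencharakterSeveral.lean` (Weil's
`J_a(𝔭)`, `J_a(𝔞)` for `a ∈ (ℤ/m)^r`, Weil's Theorem for every `r` on PRINCIPAL ideals `(α)`,
`α ≡ 1 (mod m²)`), `DeligneJacobiHeckeCharacter.lean` (Deligne's `g(𝔞, a)`) and
`DeligneJacobiGaloisCharacter.lean` (Deligne's `χ_a`).  PROOF FILE: sorry-free theorems only, no
definition, no named fact (D-0014/D-0026; net debt 0).

The tree had Weil's IDEAL factorisation (8), the absolute value (10) and the Galois equivariance (11)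
only for `r = 2` (`JacobiSumIdealCharacter.span_jacobiIdeal_eq_prod_comap_pow` = Lang's FAC 3 for
non-special `a`; `JacobiSumGrossencharakter.coe_jacobiIdeal_mul_map_eq_absNorm`, `map_coe_jacobiIdeal`;
finite-field shadows in `FermatHodgeCharacterGaussSum`) and the unit `ε(a)` of (12) for `r = 2`
(`JacobiSumIdealCharacter.exists_unit_jacobiIdeal_eq`) — here all four are proved for every `r` by
Weil's own induction on `r` (p. 492) from the `r = 2` theorems, (11) from `σ_t ζ = ζ^t` on `μ_m(𝓞)`,
(12) from (8), (10) and Kronecker's theorem (Mathlib).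

## Source, verbatim (A. Weil, *Jacobi sums as "Grössencharaktere"*, Trans. AMS 73 (1952) 487–495, §1)

p. 489–490: «Now we need the prime ideal decomposition of `J_a(𝔞)`; for a prime `𝔞` this has been
obtained by Stickelberger [7] … This gives at once, at first for a prime ideal `𝔭` and then for an
arbitrary `𝔞`, the prime ideal decomposition of `J_a(𝔞)`: **(8) `(J_a(𝔞)) = 𝔞^{ω(a)}`** where `ω(a)`
is the element of the group-ring defined by **(9)** `ω(a) = Σ_ρ θ(a_ρ) + θ(−Σ_ρ a_ρ) − Σ_t σ_t = …
= Σ_{(t,m)=1} [Σ_ρ ⟨t a_ρ/m⟩] σ_t^{-1}` [for `Σ a_ρ ≢ 0`]. The last expression, where `[ ]` denotes the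
integral part, shows that the coefficients of the `σ_t^{-1}` in `ω(a)` are integers `≥ 0` and
`≤ r − 1`»; p. 490–491: «This gives, again at first for a prime ideal and then in general: **(10)
`|J_a(𝔞)|² = N𝔞^{s−2}`** if exactly `s` of the `r + 1` integers `a_ρ`, `Σ_ρ a_ρ` are `≢ 0 (mod m)` and
`s ≥ 1`; moreover, when that is so, all the conjugates of `J_a(𝔞)` have that same absolute value since
they are given by **(11) `J_a(𝔞)^{σ_t} = J_{ta}(𝔞)`** which is an obvious consequence of (3)»; p. 492: «by
induction on `r` … `J_{a₁…a_r}(𝔞) = J_{a₂}(𝔞) J_{a₃…a_r}(𝔞) N𝔞` if `a₁ + a₂ ≡ 0`; `J_{a₁…a_r}(𝔞) =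
J_{a₁+a₂}(𝔞) J_{a₁,a₂}(𝔞) J_{a₁+a₂,a₃…a_r}(𝔞)` if `a₁ + a₂ ≢ 0`»; p. 491: «All this applies to
the case where `𝔞` is a principal ideal `(α)`. In that case we put, whenever the `a_ρ` are not all `0`:
**(12) `ε(a) = J_a((α)) α^{−ω(a)}`.** Then, by (8), `ε(a)` is a unit in `Q(ζ)`. The conjugate imaginary
to any element `β` of `Q(ζ)` is `β^{σ_{−1}}`, and more generally the conjugate imaginary to `β^ω` is
`β^{ωσ_{−1}}`, so that `|β^ω|² = β^{ω+ωσ_{−1}}`; using (6) and (9), one finds at once that all conjugates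
of `α^{ω(a)}` have the absolute value `N(α)^{(s−2)/2}`, where `s` is as above. As the field `Q(ζ)` is
purely imaginary, there is no distinction to be made between the norms of the number `α` and of the
principal ideal `(α)`. Therefore, by (10), `ε(a)` and all its conjugates have the absolute value `1`. By
a classical theorem of Kronecker, this implies that `ε(a)` is a root of unity and hence of the form
`±ζ^λ`; but we shall not need this».
P. Deligne, *Hodge cycles on abelian varieties* (LNM 900, 1982), I §7 Rem. 7.17 (re-ed. p. 55):
«`𝔞 = ∏ 𝔭ᵢ^{rᵢ} ↦ g(𝔞, a) = ∏ g(𝔭ᵢ, a)^{rᵢ} : I_d → k^×` … (Weil 1952, 1974 …)»; Thm. 7.15 (c) (p. 54):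
«… where `τ_u` is the element of `Gal(k/ℚ)` defined by `u`».

## Lean rendering (sorry-free)

`M` with `IsCyclotomicExtension {m} ℚ M` (`= ℚ(ζ)`, Weil's `ℚ(ε)`), `σ : M ≃ₐ[ℚ] M`,
`c(σ) = Rat.galEquivZMod m M σ ∈ (ℤ/m)ˣ` (`σ ζ = ζ^{c(σ)}`), `σ⁻¹𝔞 = 𝔞.comap (mapRingEquiv σ)` (as in
the `r = 2` files), `σ_t = sigma m M t`, `J_a = jacobiAtR a / jacobiIdealR a`
(`JacobiSumGrossencharakterSeveral`), `ω(a)_c = omegaCoeff a c = ⌊Σ_ρ ⟨a_ρ c/m⟩⌋ − [Σ a_ρ ≡ 0]`.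

* §1 `prod_comap_mapRingEquiv_eq_span_absNorm` — `∏_σ σ⁻¹𝔞 = (N𝔞)` in `𝓞 ℚ(μ_m)` (the tree's
  `ComplexMultiplication.prod_map_eq_span_absNorm`, reindexed), Weil's «`Σ_t σ_t`» term of (9).
* §2 **`span_jacobiIdealR_mul_pow_eq_prod_comap_pow`** — (8) in subtraction-free form:
  `(J_a(𝔞)) · (N𝔞)^{[Σa≡0]} = ∏_σ (σ⁻¹𝔞)^{⌊Σ_ρ ⟨a_ρ c(σ)/m⟩⌋}` for `a ≠ 0` and `𝔞 ≠ 0` prime to `m`, by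
  Weil's induction (vanishing exponent dropped; `a₁ + a₂ ≡ 0`: the special pair is a unit and `N𝔞`
  appears; `a₁ + a₂ ≢ 0`: the tree's `r = 2` factorisation of `J_{(a₁,a₂)}(𝔞)`);
  **`span_jacobiIdealR_eq_prod_comap_pow`** — **(8) «`(J_a(𝔞)) = 𝔞^{ω(a)}`» for every `r`**;
  `span_deligneJacobiIdeal_eq_prod_comap_pow` — for `a ∈ X(S)` with no `aᵢ = 0`:
  `(J_a(𝔞)) = ∏_σ (σ⁻¹𝔞)^{⟨c(σ)a⟩ − 1}` (Deligne's normalisation, `⟨a⟩ = Σ⟨aᵢ/d⟩`).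
* §3 `mapRingEquiv_eq_pow_of_pow_eq_one` (`σ_t u = u^t` on `μ_m(𝓞)`), `map_jacobiSumAt`,
  `ringHomComp_residueChar_sigma` (`σ_t ∘ χ_𝔭 = χ_𝔭^t`), **`mapRingEquiv_sigma_jacobiAtR`** and
  **`mapRingEquiv_sigma_jacobiIdealR`** — **(11) «`J_a(𝔞)^{σ_t} = J_{ta}(𝔞)`»**;
  `mapRingEquiv_sigma_deligneJacobiIdeal`, **`sigma_deligneG`** (`σ_t g(𝔞, a) = N𝔞^{⟨ta⟩−⟨a⟩} g(𝔞, ta)`)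
  and **`sigma_deligneG_of_const`** (`= g(𝔞, ta)` under the hypothesis of Thm. 7.15), `const_smul`.
* §4 **`deligneChi_smul`** — `χ_{ta} = τ_t ∘ χ_a` for Deligne's Galois characters
  (`DeligneJacobiGaloisCharacter.deligneChi`), by the uniqueness theorem `eq_deligneChi` and (11): the
  Galois-character form of Thm. 7.15 (c) «`λ_{ua}(σ) = τ_u(λ_a(σ))`»; `coe_deligneChi_smul_apply`.
* §5 `sigma_neg_one_coe_jacobiIdeal`, `coe_jacobiIdeal_mul_neg` (non-special pair: `J(b,𝔞)J(−b,𝔞) = N𝔞`),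
  `coe_jacobiIdeal_mul_neg_of_isSpecial` (special pair: `= 1`),
  **`coe_jacobiIdealR_mul_neg_eq_absNorm_pow`** — **(10) for every `r`**, algebraic form
  `J_a(𝔞) · J_{−a}(𝔞) = N𝔞^{s−2}` for `a` with no `a_ρ ≡ 0` (`s = r + 1 + [Σ a_ρ ≢ 0]` for `r + 1`
  exponents), by Weil's induction; `coe_deligneJacobiIdeal_mul_neg` (`a ∈ X(S)`: `= N𝔞ⁿ`, weight `n`);
  **`norm_map_jacobiIdealR_sq`** — (10) as printed, `|φ(J_a(𝔞))|² = N𝔞^{s−2}` for every complex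
  embedding `φ` (complex conjugation `= σ_{−1}`, and (11)); `norm_map_deligneG_sq`
  (`|φ(g(𝔞, a))|² = N𝔞^{n+2−2⟨a⟩}`).
* §6 `galPow_sigma_eq_coe_prod` (`α^θ = ∏_σ (σ̃⁻¹α)^{θ_{c(σ)}}`), `span_jacobiIdealR_span_singleton_eq`
  ((8) at `𝔞 = (α)`), `associated_jacobiIdealR`, **`exists_unit_jacobiIdealR_eq`** — **(12) «by (8),
  `ε(a)` is a unit»**, every `r`: `J_a((α)) = ε · α^{ω(a)}` with `ε ∈ 𝓞ˣ` for `α ≠ 0` prime to `m`,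
  `a ≠ 0`; `omegaCoeff_add_omegaCoeff_neg` (`ω(a)_c + ω(a)_{−c} = s − 2`, Weil's use of (6) and (9)),
  `norm_map_galPow_omegaCoeff_sq` («all conjugates of `α^{ω(a)}` have the absolute value
  `N(α)^{(s−2)/2}`»), **`exists_unit_jacobiIdealR_eq_mul_galPow`** — **(12) in full** for `m > 2` and no
  `a_ρ ≡ 0`: `ε` is a unit, `|φ(ε)| = 1` for every `φ`, and `ε^N = 1` for some `N ≥ 1` (Kronecker);
  `exists_jacobiIdealR_span_singleton_eq_zeta_pow_mul` («hence of the form `±ζ^λ`», `m` odd).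

## Honest column

* (8) is proved for integral `𝔞 ≠ 0` prime to `m` (Weil's `J_a(𝔞)` is only defined there) and `a ≠ 0`;
  the «symbolic power» `𝔞^{ω(a)}` is written out as the product over `Gal(ℚ(μ_m)/ℚ)` with the tree's
  indexing `σ ↦ (σ⁻¹𝔞)^{ω(a)_{c(σ)}}` (Weil's `Σ_t ω_t σ_t^{-1}`).
* (11) is proved with the SAME ideal `𝔞` on both sides, as printed (the automorphism acts on the
  algebraic integer `J_a(𝔞)`, not on `𝔞`).
* (10) is proved for tuples with no `a_ρ ≡ 0` (then `s = r + 1 + [Σ a_ρ ≢ 0] ≥ 2` automatically);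
  tuples with vanishing exponents reduce to these by `jacobiIdealR_eq_of_head_eq_zero` (not restated).
* The normalisation is the level-`1` one of the sibling files (`J_a(𝔭) = (−1)^{r+1} Σ_{Σx=1} ∏ χ_𝔭^{a_ρ}`;
  Weil's level `−1` differs by `χ_𝔭^{Σa}(−1)`, a unit, so (8) is literally the same statement).
* `χ_{ta} = τ_t ∘ χ_a` (§4) is not printed as such by Deligne (he states the analogue for `λ_a` in
  Thm. 7.15 (c)); it is our consequence of Weil's (11) and the uniqueness clause of Rem. 7.17.
* (12): the unit is proved for every `a ≠ 0` and `α ≠ 0` prime to `m` (hypothesis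
  `IsCoprime (α) (m)`, as in the `r = 2` file); the absolute value `1` and the root-of-unity clause for
  `m > 2` and tuples with no `a_ρ ≡ 0` (as for (10)); the form `±ζ^λ` only for odd `m` (Mathlib's
  description of the roots of unity of `ℚ(μ_m)`; for even `m` they are the `ζ^λ`, not restated).
  Weil adds «but we shall not need this»; neither does the tree (for `α ≡ 1 (mod m²)`, `ε(a) = 1` is
  `coe_jacobiIdealR_span_singleton_eq_galPow`).

## References

* A. Weil, *Jacobi sums as "Grössencharaktere"*, Trans. AMS 73 (1952) 487–495, §1 (6), (8), (9), (10),
  (11), (12), p. 492. [Weil1952JacobiSums]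
* P. Deligne (notes by J. S. Milne), *Hodge cycles on abelian varieties*, LNM 900 (1982), I §7 Thm. 7.15 (c),
  Rem. 7.17. [Deligne1982HodgeCycles]
* S. Lang, *Cyclotomic Fields I and II*, GTM 121 (1990), Ch. 1 §1 (σ_c), §2 FAC 3, §4. [Lang1990]
* J. Neukirch, *Algebraic Number Theory* (1999), Ch. I Prop. (2.6). [NeukirchANT1999]

## Mathlib / tree search

Tree (reused by name): `jacobiAtR`, `jacobiIdealR`, `omegaCoeff`, `jacobiIdealR_eq_of_head_eq_zero`,
`jacobiIdealR_eq_mul_of_add_ne_zero`, `jacobiIdealR_eq_mul_absNorm_mul_of_add_eq_zero`,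
`one_le_sum_val_div` (`JacobiSumGrossencharakterSeveral`); `span_jacobiIdeal_eq_prod_comap_pow`,
`residueChar`, `sigma` (`JacobiSumIdealCharacter`); `coe_jacobiIdeal_sq_of_isSpecial`, `sigma_zeta`,
`sigma_neg_one_zeta`, `map_coe_jacobiIdeal`, `coe_jacobiIdeal_mul_map_eq_absNorm`, `thetaCoeff_spec`
(`JacobiSumGrossencharakter`, `JacobiSumHeckeCharacterModulus`); `conjugate_eq_comp_sigma_neg_one`
(`JacobiSumGrossencharakterInfinityType`); `deligneJacobiIdeal`,
`deligneG`, `omegaCoeff_eq_of_sum_eq_zero` (`DeligneJacobiHeckeCharacter`); `sum_eq_zero_of_const`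
(`FermatGaussProductRootOfUnity`); `prod_map_eq_span_absNorm` (`ComplexMultiplication.ReflexNormIdeal`);
`deligneChi`, `eq_deligneChi`, `deligneChi_geomFrob`, `isOpen_ker_deligneChi`
(`DeligneJacobiGaloisCharacter`); `not_mem_of_mem_normalizedFactors_span` (`JacobiSumIdealCharacter`),
`map_galPow_neg_one` (`JacobiSumHeckeCharacterModulus`), `absNorm_span_singleton_eq_prod_sigma`
(`JacobiSumGrossencharakter`).  Mathlib: `IsPrimitiveRoot.eq_pow_of_pow_eq_one`,
`MulChar.ringHomComp_pow`, `Ideal.map_symm`, `Algebra.IsAlgebraic.algEquivEquivAlgHom`,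
`IsUnit.of_pow_eq_one`, `NumberField.Embeddings.pow_eq_one_of_norm_eq_one` (Kronecker),
`IsPrimitiveRoot.exists_pow_or_neg_mul_pow_of_isOfFinOrder`, `Nat.add_div_eq_of_le_mod_add_mod`.
`lean search 'span_jacobiIdealR_eq_prod|sigma_jacobiAtR|deligneChi_smul|unit_jacobiIdealR'`: no
prior hits.
-/

noncomputable section

open Finset

namespace Literature.NumberTheory.GaussSums.JacobiSumIdeal

open NumberField IsCyclotomicExtension UniqueFactorizationMonoid IsDedekindDomain
open JacobiSumHeckeCharacter FermatGaussProduct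

variable {m : ℕ} [NeZero m] {M : Type*} [Field M] [NumberField M] [hM : IsCyclotomicExtension {m} ℚ M]

/-! ### §1. `∏_σ σ⁻¹𝔞 = (N𝔞)` -/

section Norm

/-- **`∏_{σ ∈ Gal(ℚ(μ_m)/ℚ)} σ⁻¹𝔞 = N(𝔞)·𝓞`** for every integral ideal `𝔞` of `ℚ(μ_m)` (the norm as the
product of the conjugates in a Galois extension; the tree's `prod_map_eq_span_absNorm` — Shimura §8.3 /
Neukirch I (2.6) — reindexed by `σ ↦ σ⁻¹`, `𝔞.comap σ = 𝔞.map σ⁻¹`).  This is the term `Σ_t σ_t` of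
Weil's (9) and his «`N𝔞`» in the first reduction relation.
[cite: Weil1952JacobiSums, §1 (9), p. 490; p. 492 (first relation)] [cite: NeukirchANT1999, Ch. I Prop. (2.6) (iii)] -/
theorem prod_comap_mapRingEquiv_eq_span_absNorm [IsGalois ℚ M] (𝔞 : Ideal (𝓞 M)) :
    ∏ σ : M ≃ₐ[ℚ] M, 𝔞.comap (RingOfIntegers.mapRingEquiv (σ : M ≃+* M)) =
      Ideal.span {((Ideal.absNorm 𝔞 : ℕ) : 𝓞 M)} := by
  rw [← ComplexMultiplication.prod_map_eq_span_absNorm (AlgHom.id ℚ M) 𝔞]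
  -- `σ ↦ σ⁻¹` then `AlgEquiv ≃ AlgHom`
  refine Fintype.prod_equiv
    ((Equiv.inv (M ≃ₐ[ℚ] M)).trans (Algebra.IsAlgebraic.algEquivEquivAlgHom ℚ M).toEquiv) _ _
    fun σ => ?_
  show 𝔞.comap _ = 𝔞.map (RingOfIntegers.mapRingHom
    (((Algebra.IsAlgebraic.algEquivEquivAlgHom ℚ M) σ⁻¹ : M →ₐ[ℚ] M) : M →+* M))
  rw [← Ideal.map_symm, ← Ideal.map_coe]
  congr 1

end Norm

omit [NeZero m] in
include hM in
/-- `ℚ(μ_m)/ℚ` is Galois. [folklore] -/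
private theorem isGalois_cycl : IsGalois ℚ M := IsCyclotomicExtension.isGalois {m} ℚ M

/-! ### §2. Weil's (8) for every `r` -/

section Factorisation

/-- A special pair `a = (s, −s)`, `s ≠ 0`, contributes a UNIT: `(J_{(s,−s)}(𝔞)) = 𝓞`
(`J(a, 𝔞) = ±1`, tree `coe_jacobiIdeal_sq_of_isSpecial`). [cite: Weil1952JacobiSums, §1 p. 489 («J₁(𝔞) … = χ_𝔭(−1)»), p. 492] [cite: Lang1990, Ch. 1 §4 («J(a, 𝔞) = 1 or −1»)] -/
theorem span_jacobiIdeal_eq_top_of_isSpecial {a : Fin 2 → ZMod m} (ha : IsSpecial a) (ha0 : a ≠ 0)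
    (𝔞 : Ideal (𝓞 M)) : Ideal.span {jacobiIdeal a 𝔞} = ⊤ := by
  rw [Ideal.span_singleton_eq_top]
  have h2 : (jacobiIdeal a 𝔞) ^ 2 = 1 := by
    apply RingOfIntegers.coe_injective
    push_cast
    exact coe_jacobiIdeal_sq_of_isSpecial ha ha0 𝔞
  exact IsUnit.of_pow_eq_one h2 two_ne_zero

omit hM in
/-- `x.val + (−x).val = m` for `x ≠ 0` in `ℤ/m`. [folklore] -/
private theorem val_add_val_neg' {x : ZMod m} (hx : x ≠ 0) : x.val + (-x).val = m := by
  rw [ZMod.neg_val, if_neg hx, Nat.add_sub_cancel' (ZMod.val_le x)]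

omit [NeZero m] hM in
/-- `Σ_{ρ < k+2} f(ρ) = f(0) + f(1) + Σ_{i < k} f(i+2)`. [folklore] -/
private theorem sum_univ_add_two' {β : Type*} [AddCommMonoid β] {k : ℕ} (f : Fin (k + 2) → β) :
    ∑ ρ, f ρ = f 0 + f 1 + ∑ i : Fin k, f i.succ.succ := by
  rw [Fin.sum_univ_succ, Fin.sum_univ_succ, ← add_assoc, Fin.succ_zero_eq_one]

/-- **Weil's (8), subtraction-free form, for every `r`.**  For `𝔞 ≠ 0` prime to `m` and
`a ∈ (ℤ/m)^r`, `a ≠ 0`: `(J_a(𝔞)) · (N𝔞)^{[Σ_ρ a_ρ ≡ 0]} = ∏_σ (σ⁻¹𝔞)^{⌊Σ_ρ ⟨a_ρ c(σ)/m⟩⌋}`, i.e.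
`(J_a(𝔞)) = 𝔞^{ω(a)}` with `ω(a) = Σ_ρ θ(a_ρ) + θ(−Σ a_ρ) − Σ_t σ_t` ((9)), by Weil's induction on `r`
(p. 492) from the tree's `r = 2` factorisation `span_jacobiIdeal_eq_prod_comap_pow` (Lang's FAC 3).
[cite: Weil1952JacobiSums, §1 (8)–(9), p. 490; p. 492 («by induction on r»)] [cite: Lang1990, Ch. 1 §2 FAC 3] -/
theorem span_jacobiIdealR_mul_pow_eq_prod_comap_pow {𝔞 : Ideal (𝓞 M)} (h𝔞 : 𝔞 ≠ ⊥)
    (h𝔞m : ∀ 𝔭 ∈ normalizedFactors 𝔞, (m : 𝓞 M) ∉ 𝔭) {r : ℕ} (a : Fin r → ZMod m) (ha : a ≠ 0) :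
    Ideal.span {jacobiIdealR a 𝔞} *
        Ideal.span {((Ideal.absNorm 𝔞 : ℕ) : 𝓞 M)} ^ (if ∑ ρ, a ρ = 0 then 1 else 0) =
      ∏ σ : M ≃ₐ[ℚ] M, (𝔞.comap (RingOfIntegers.mapRingEquiv (σ : M ≃+* M))) ^
        ((∑ ρ, (a ρ * ((Rat.galEquivZMod m M σ : (ZMod m)ˣ) : ZMod m)).val) / m) := by
  classical
  haveI : IsGalois ℚ M := isGalois_cycl (m := m)
  -- strong induction on `r`
  induction r using Nat.strong_induction_on with
  | _ r ih =>
  rcases r with _ | _ | k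
  · -- `r = 0`: no nonzero `a`
    exact absurd (Subsingleton.elim a 0) ha
  · -- `r = 1`: `J = 1`, exponents `⌊⟨a₁c/m⟩⌋ = 0`, `Σ a_ρ = a₁ ≠ 0`
    have ha1 : a 0 ≠ 0 := fun h => ha (by funext ρ; fin_cases ρ; exact h)
    have hι : (∑ ρ, a ρ) ≠ 0 := by rwa [Fin.sum_univ_one]
    rw [if_neg hι, pow_zero, mul_one, jacobiIdealR_fin_one, Ideal.span_singleton_one, ← Ideal.one_eq_top]
    symm
    refine prod_eq_one fun σ _ => ?_
    rw [Fin.sum_univ_one, Nat.div_eq_of_lt (ZMod.val_lt _), pow_zero]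
  · -- `r = k + 2`
    by_cases hz : ∃ ρ, a ρ = 0
    · -- a vanishing exponent: move it to the front and drop it
      obtain ⟨ρ, hρ⟩ := hz
      set e : Fin (k + 2) ≃ Fin (k + 2) := Equiv.swap 0 ρ with he
      set a' : Fin (k + 2) → ZMod m := fun j => a (e j) with ha'
      have ha'0 : a' 0 = 0 := by
        simp only [ha', he, Equiv.swap_apply_left]
        exact hρ
      have htail : Fin.tail a' ≠ 0 := by
        intro h0
        apply ha
        funext x
        have hall : ∀ y, a' y = 0 := fun y => by
          refine Fin.cases ha'0 (fun i => ?_) y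
          exact congrFun h0 i
        have := hall (e x)
        simp only [ha', he, Equiv.swap_apply_self] at this
        exact this
      obtain ⟨i₀, hi₀⟩ := Function.ne_iff.mp htail
      have hJ : jacobiIdealR a 𝔞 = jacobiIdealR (Fin.tail a') 𝔞 := by
        rw [← jacobiIdealR_comp_equiv e a, jacobiIdealR_eq_of_head_eq_zero a' ha'0 hi₀]
      have hsum : ∑ ρ, a ρ = ∑ i, Fin.tail a' i := by
        rw [← Equiv.sum_comp e a, Fin.sum_univ_succ]
        change a' 0 + _ = _
        rw [ha'0, zero_add]
        rfl
      have hS : ∀ c : ZMod m, ∑ ρ, (a ρ * c).val = ∑ i, (Fin.tail a' i * c).val := fun c => by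
        rw [← Equiv.sum_comp e (fun ρ => (a ρ * c).val), Fin.sum_univ_succ]
        change (a' 0 * c).val + _ = _
        rw [ha'0, zero_mul, ZMod.val_zero, zero_add]
        rfl
      rw [hJ, hsum]
      simp_rw [hS]
      exact ih (k + 1) (by omega) (Fin.tail a') htail
    · push Not at hz
      by_cases hs : a 0 + a 1 = 0
      · -- `a₁ + a₂ ≡ 0`: the special pair `(a₁, a₂)` is a unit, and `N𝔞` appears
        have ha1 : a 1 = -a 0 := eq_neg_of_add_eq_zero_right hs
        have hvv : ∀ c : (ZMod m)ˣ, (a 0 * (c : ZMod m)).val + (a 1 * (c : ZMod m)).val = m := fun c => by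
          rw [ha1, neg_mul]
          exact val_add_val_neg' (mt (Units.mul_left_eq_zero c).mp (hz 0))
        have hspec : IsSpecial ![a 0, a 1] := Or.inr (Or.inr (by simpa using hs))
        have hne0 : (![a 0, a 1] : Fin 2 → ZMod m) ≠ 0 := fun h => hz 0 (by simpa using congrFun h 0)
        rcases k with _ | k'
        · -- `r = 2`
          have ha2 : a = ![a 0, a 1] := by funext ρ; fin_cases ρ <;> rfl
          have hι : (∑ ρ, a ρ) = 0 := by rw [Fin.sum_univ_two, hs]
          rw [if_pos hι, pow_one, jacobiIdealR_fin_two, ← prod_comap_mapRingEquiv_eq_span_absNorm 𝔞]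
          conv_lhs => rw [ha2, span_jacobiIdeal_eq_top_of_isSpecial hspec hne0 𝔞, Ideal.top_mul]
          refine prod_congr rfl fun σ _ => ?_
          rw [Fin.sum_univ_two, hvv, Nat.div_self (NeZero.pos m), pow_one]
        · -- `r ≥ 3`: Weil's first relation
          set b : Fin (k' + 1) → ZMod m := Fin.tail (Fin.tail a) with hb
          have hb0 : a (0 : Fin (k' + 1)).succ.succ ≠ 0 := hz _
          have hbne : b ≠ 0 := fun h => hb0 (congrFun h 0)
          have hι : (∑ ρ, a ρ) = ∑ i, b i := by
            rw [sum_univ_add_two', hs, zero_add, hb]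
            rfl
          have hS : ∀ c : (ZMod m)ˣ, ∑ ρ, (a ρ * (c : ZMod m)).val = ∑ i, (b i * (c : ZMod m)).val + m * 1 :=
            fun c => by
            rw [sum_univ_add_two' (fun ρ => (a ρ * (c : ZMod m)).val)]
            have := hvv c
            simp only [hb, Fin.tail]
            omega
          have hih := ih (k' + 1) (by omega) b hbne
          rw [hι, jacobiIdealR_eq_mul_absNorm_mul_of_add_eq_zero a (hz 0) hs hb0 h𝔞 h𝔞m,
            ← Ideal.span_singleton_mul_span_singleton, ← Ideal.span_singleton_mul_span_singleton,
            span_jacobiIdeal_eq_top_of_isSpecial hspec hne0 𝔞, Ideal.top_mul]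
          simp_rw [hS, Nat.add_mul_div_left _ _ (NeZero.pos m), pow_add, prod_mul_distrib, pow_one]
          rw [← hih, prod_comap_mapRingEquiv_eq_span_absNorm 𝔞, ← hb]
          ring
      · -- `a₁ + a₂ ≢ 0`: Weil's second relation with the non-special pair `(a₁, a₂)`
        set a'' : Fin (k + 1) → ZMod m := Fin.cons (a 0 + a 1) (Fin.tail (Fin.tail a)) with ha''
        have ha''0 : a'' ≠ 0 := fun h => hs (by
          have := congrFun h 0
          simpa [ha''] using this)
        have hJ := jacobiIdealR_eq_mul_of_add_ne_zero a hs 𝔞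
        have hpair : Ideal.span {jacobiIdeal ![a 0, a 1] 𝔞} =
            ∏ σ : M ≃ₐ[ℚ] M, (𝔞.comap (RingOfIntegers.mapRingEquiv (σ : M ≃+* M))) ^
              thetaCoeff ![a 0, a 1] ((Rat.galEquivZMod m M σ : (ZMod m)ˣ) : ZMod m) :=
          span_jacobiIdeal_eq_prod_comap_pow h𝔞 h𝔞m _ (by simpa using hz 0) (by simpa using hz 1)
            (by simpa using hs)
        have hι : (∑ ρ, a ρ) = ∑ j, a'' j := by
          rw [sum_univ_add_two', Fin.sum_univ_succ]
          simp only [ha'', Fin.cons_zero, Fin.cons_succ]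
          rfl
        have hS : ∀ c : (ZMod m)ˣ, ∑ ρ, (a ρ * (c : ZMod m)).val =
            ∑ j, (a'' j * (c : ZMod m)).val + m * thetaCoeff ![a 0, a 1] (c : ZMod m) := fun c => by
          rw [sum_univ_add_two' (fun ρ => (a ρ * (c : ZMod m)).val), Fin.sum_univ_succ]
          have hspec := thetaCoeff_spec ![a 0, a 1] (c : ZMod m)
          simp only [Matrix.cons_val_zero, Matrix.cons_val_one] at hspec
          simp only [ha'', Fin.cons_zero, Fin.cons_succ, Fin.tail]
          omega
        have hih := ih (k + 1) (by omega) a'' ha''0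
        rw [hι, hJ, ← Ideal.span_singleton_mul_span_singleton]
        simp_rw [hS, Nat.add_mul_div_left _ _ (NeZero.pos m), pow_add, prod_mul_distrib]
        rw [← hih, ← hpair]
        ring

/-- **Weil 1952 (8) «`(J_a(𝔞)) = 𝔞^{ω(a)}`» for EVERY number `r` of exponents**: for an integral ideal
`𝔞 ≠ 0` of `ℚ(μ_m)` prime to `m` and `a ∈ (ℤ/m)^r`, `a ≠ 0`,
`(J_a(𝔞)) = ∏_{σ ∈ Gal(ℚ(μ_m)/ℚ)} (σ⁻¹𝔞)^{ω(a)_{c(σ)}}` with Weil's exponents (9)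
`ω(a)_c = ⌊Σ_ρ ⟨a_ρ c/m⟩⌋ − [Σ_ρ a_ρ ≡ 0]` (`omegaCoeff`) — Stickelberger's factorisation of the
Jacobi-sum ideal, general `r` (the tree's `span_jacobiIdeal_eq_prod_comap_pow` is `r = 2`).
[cite: Weil1952JacobiSums, §1 (8)–(9), p. 490] [cite: Lang1990, Ch. 1 §2 FAC 3 (r = 2)] -/
theorem span_jacobiIdealR_eq_prod_comap_pow {𝔞 : Ideal (𝓞 M)} (h𝔞 : 𝔞 ≠ ⊥)
    (h𝔞m : ∀ 𝔭 ∈ normalizedFactors 𝔞, (m : 𝓞 M) ∉ 𝔭) {r : ℕ} (a : Fin r → ZMod m) (ha : a ≠ 0) :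
    Ideal.span {jacobiIdealR a 𝔞} =
      ∏ σ : M ≃ₐ[ℚ] M, (𝔞.comap (RingOfIntegers.mapRingEquiv (σ : M ≃+* M))) ^
        omegaCoeff a ((Rat.galEquivZMod m M σ : (ZMod m)ˣ) : ZMod m) := by
  classical
  haveI : IsGalois ℚ M := isGalois_cycl (m := m)
  have h := span_jacobiIdealR_mul_pow_eq_prod_comap_pow h𝔞 h𝔞m a ha
  by_cases hsum : ∑ ρ, a ρ = 0
  · rw [if_pos hsum, pow_one] at h
    have hN : Ideal.span {((Ideal.absNorm 𝔞 : ℕ) : 𝓞 M)} ≠ 0 := by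
      rw [Ne, Submodule.zero_eq_bot, Ideal.span_singleton_eq_bot, Nat.cast_eq_zero,
        Ideal.absNorm_eq_zero_iff]
      exact h𝔞
    have hsplit : (∏ σ : M ≃ₐ[ℚ] M, (𝔞.comap (RingOfIntegers.mapRingEquiv (σ : M ≃+* M))) ^
        ((∑ ρ, (a ρ * ((Rat.galEquivZMod m M σ : (ZMod m)ˣ) : ZMod m)).val) / m)) =
        (∏ σ : M ≃ₐ[ℚ] M, (𝔞.comap (RingOfIntegers.mapRingEquiv (σ : M ≃+* M))) ^
          omegaCoeff a ((Rat.galEquivZMod m M σ : (ZMod m)ˣ) : ZMod m)) *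
          Ideal.span {((Ideal.absNorm 𝔞 : ℕ) : 𝓞 M)} := by
      rw [← prod_comap_mapRingEquiv_eq_span_absNorm 𝔞, ← prod_mul_distrib]
      refine prod_congr rfl fun σ _ => ?_
      rw [← pow_succ, omegaCoeff_def, if_pos hsum,
        Nat.sub_add_cancel (one_le_sum_val_div a ha hsum _)]
    rw [hsplit] at h
    exact mul_right_cancel₀ hN h
  · rw [if_neg hsum, pow_zero, mul_one] at h
    rw [h]
    refine prod_congr rfl fun σ _ => ?_
    rw [omegaCoeff_def, if_neg hsum, Nat.sub_zero]

/-- **The factorisation of Deligne's `J_a(𝔞)`** for `a ∈ X(S)` (`Σ aᵢ = 0`) with no `aᵢ = 0`: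
`(J_a(𝔞)) = ∏_σ (σ⁻¹𝔞)^{⟨c(σ) a⟩ − 1}` for `𝔞 ≠ 0` prime to `d = m` (`⟨a⟩ = Σᵢ ⟨aᵢ/d⟩ ≥ 1`; Weil's (8)
with `ω(a)_c = ⟨ca⟩ − 1`, `omegaCoeff_eq_of_sum_eq_zero`), so that `g(𝔞, a) = N𝔞^{1−⟨a⟩} J_a(𝔞)`
generates the fractional ideal `∏_σ (σ⁻¹𝔞)^{⟨c(σ)a⟩ − ⟨a⟩}` («Weil's determination of `χ_alg`»).
[cite: Weil1952JacobiSums, §1 (8)–(9), p. 490] [cite: Deligne1982HodgeCycles, I §7 Lemma 7.9 («q^{⟨a⟩−1} g(𝔭, a)») and Rem. 7.17 (p. 55)] -/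
theorem span_deligneJacobiIdeal_eq_prod_comap_pow {𝔞 : Ideal (𝓞 M)} (h𝔞 : 𝔞 ≠ ⊥)
    (h𝔞m : ∀ 𝔭 ∈ normalizedFactors 𝔞, (m : 𝓞 M) ∉ 𝔭) {n : ℕ} (a : Fin (n + 2) → ZMod m)
    (ha : ∀ i, a i ≠ 0) (hsum : ∑ i, a i = 0) :
    Ideal.span {deligneJacobiIdeal a 𝔞} =
      ∏ σ : M ≃ₐ[ℚ] M, (𝔞.comap (RingOfIntegers.mapRingEquiv (σ : M ≃+* M))) ^
        ((∑ i, (((Rat.galEquivZMod m M σ : (ZMod m)ˣ) : ZMod m) * a i).val) / m - 1) := by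
  have ha0 : a ≠ 0 := fun h => ha 0 (congrFun h 0)
  rw [deligneJacobiIdeal_eq_jacobiIdealR a (ha 0) hsum, span_jacobiIdealR_eq_prod_comap_pow h𝔞 h𝔞m a ha0]
  refine prod_congr rfl fun σ _ => ?_
  rw [omegaCoeff_eq_of_sum_eq_zero a hsum]

end Factorisation

/-! ### §3. Weil's (11): `J_a(𝔞)^{σ_t} = J_{ta}(𝔞)` -/

section GaloisAction

/-- **`σ_t u = u^t` on `μ_m(𝓞 ℚ(μ_m))`**: for an `m`-th root of unity `u` of `𝓞 ℚ(μ_m)` and `t ∈ (ℤ/m)ˣ`,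
`σ_t(u) = u^t` (`u = ζ^i` and `σ_t ζ = ζ^t`, tree `sigma_zeta`). [cite: Lang1990, Ch. 1 §1 («σ_c : ζ ↦ ζ^c»)] [cite: Weil1952JacobiSums, §1 p. 488 («σ_t … ε → ε^t»)] -/
theorem mapRingEquiv_sigma_eq_pow_of_pow_eq_one (t : (ZMod m)ˣ) {u : 𝓞 M} (hu : u ^ m = 1) :
    RingOfIntegers.mapRingEquiv (sigma m M t : M ≃+* M) u = u ^ (t : ZMod m).val := by
  have hζ := (zeta_spec m ℚ M).toInteger_isPrimitiveRoot
  obtain ⟨i, -, rfl⟩ := hζ.eq_pow_of_pow_eq_one hu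
  rw [map_pow, ← pow_mul, mul_comm i, pow_mul]
  congr 1
  refine RingOfIntegers.eq_iff.mp ?_
  rw [RingOfIntegers.mapRingEquiv_apply]
  push_cast
  change sigma m M t (zeta m ℚ M) = zeta m ℚ M ^ (t : ZMod m).val
  exact sigma_zeta t

/-- A ring homomorphism commutes with the hyperplane sums: `f(J_s(χ)) = J_s(f ∘ χ)`. [folklore] -/
private theorem map_jacobiSumAt {F : Type*} [Field F] [Fintype F] [DecidableEq F] {R R' : Type*}
    [CommRing R] [CommRing R'] {ι : Type*} [Fintype ι] [DecidableEq ι] (f : R →+* R')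
    (χ : ι → MulChar F R) (s : F) :
    f (jacobiSumAt χ s) = jacobiSumAt (fun i => (χ i).ringHomComp f) s := by
  rw [jacobiSumAt_def, jacobiSumAt_def, map_sum]
  refine sum_congr rfl fun x _ => ?_
  simp only [map_prod, MulChar.ringHomComp_apply]

/-- **`σ_t ∘ χ_𝔭 = χ_𝔭^t`**: the automorphism `σ_t` of `ℚ(μ_m)` acts on the values of the residue
character `χ_𝔭` (which are `m`-th roots of unity) by `t`-th powers (Weil: `Ω(ε) = Ω₁(ε^t)`, `σ_t`).
[cite: Weil1952JacobiSums, §1 p. 488] [cite: Lang1990, Ch. 1 §1 (σ_c)] -/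
theorem ringHomComp_residueChar_sigma (𝔭 : Ideal (𝓞 M)) [𝔭.IsMaximal] (hm : (m : 𝓞 M) ∉ 𝔭)
    (t : (ZMod m)ˣ) :
    (residueChar 𝔭 hm).ringHomComp
        (RingOfIntegers.mapRingEquiv (sigma m M t : M ≃+* M) : 𝓞 M →+* 𝓞 M) =
      residueChar 𝔭 hm ^ (t : ZMod m).val := by
  refine MulChar.ext fun u => ?_
  rw [MulChar.ringHomComp_apply, MulChar.pow_apply_coe, RingEquiv.coe_toRingHom]
  exact mapRingEquiv_sigma_eq_pow_of_pow_eq_one t (by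
    rw [← MulChar.pow_apply_coe, residueChar_pow, MulChar.one_apply_coe])

/-- **Weil 1952 (11) at a prime: `J_a(𝔭)^{σ_t} = J_{ta}(𝔭)`** for `a ∈ (ℤ/m)^r`, any `r`, `t ∈ (ℤ/m)ˣ`
(«an obvious consequence of (3)»: `σ_t` raises the values of `χ_𝔭` to the `t`-th power; the ideal
`𝔭` is the same on both sides). [cite: Weil1952JacobiSums, §1 (11), p. 491] -/
theorem mapRingEquiv_sigma_jacobiAtR (t : (ZMod m)ˣ) {r : ℕ} (a : Fin r → ZMod m) (𝔭 : Ideal (𝓞 M)) :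
    RingOfIntegers.mapRingEquiv (sigma m M t : M ≃+* M) (jacobiAtR a 𝔭) =
      jacobiAtR ((t : ZMod m) • a) 𝔭 := by
  by_cases h : 𝔭.IsMaximal ∧ (m : 𝓞 M) ∉ 𝔭
  · haveI := h.1
    letI := Ideal.Quotient.field 𝔭
    letI := Fintype.ofFinite (𝓞 M ⧸ 𝔭)
    letI : DecidableEq (𝓞 M ⧸ 𝔭) := Classical.decEq _
    rw [jacobiAtR_eq a 𝔭 h.2, jacobiAtR_eq _ 𝔭 h.2, map_mul, map_pow, map_neg, map_one]
    congr 1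
    rw [← RingEquiv.coe_toRingHom, map_jacobiSumAt]
    have hord := orderOf_residueChar 𝔭 h.2
    congr 1
    funext ρ
    rw [← MulChar.ringHomComp_pow, ringHomComp_residueChar_sigma 𝔭 h.2 t, ← pow_mul,
      ← pow_mod_orderOf (residueChar 𝔭 h.2) ((t : ZMod m).val * (a ρ).val), hord, Pi.smul_apply,
      smul_eq_mul, ZMod.val_mul]
  · rw [jacobiAtR_of_not a 𝔭 h, jacobiAtR_of_not _ 𝔭 h, map_one]

/-- **Weil 1952 (11): `J_a(𝔞)^{σ_t} = J_{ta}(𝔞)`** for every integral ideal `𝔞` of `ℚ(μ_m)`, every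
`a ∈ (ℤ/m)^r` and `t ∈ (ℤ/m)ˣ` — «all the conjugates of `J_a(𝔞)` … are given by (11)».
[cite: Weil1952JacobiSums, §1 (11), p. 491] -/
theorem mapRingEquiv_sigma_jacobiIdealR (t : (ZMod m)ˣ) {r : ℕ} (a : Fin r → ZMod m)
    (𝔞 : Ideal (𝓞 M)) :
    RingOfIntegers.mapRingEquiv (sigma m M t : M ≃+* M) (jacobiIdealR a 𝔞) =
      jacobiIdealR ((t : ZMod m) • a) 𝔞 := by
  classical
  rw [jacobiIdealR_def, jacobiIdealR_def, map_multiset_prod, Multiset.map_map]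
  refine congrArg _ (Multiset.map_congr rfl fun 𝔭 _ => ?_)
  exact mapRingEquiv_sigma_jacobiAtR t a 𝔭

/-- `σ_t(J_a(𝔞)) = J_{ta}(𝔞)` read in `k = ℚ(μ_m)`. [cite: Weil1952JacobiSums, §1 (11), p. 491] -/
theorem sigma_coe_jacobiIdealR (t : (ZMod m)ˣ) {r : ℕ} (a : Fin r → ZMod m) (𝔞 : Ideal (𝓞 M)) :
    sigma m M t (jacobiIdealR a 𝔞 : M) = (jacobiIdealR ((t : ZMod m) • a) 𝔞 : M) := by
  rw [← mapRingEquiv_sigma_jacobiIdealR t a 𝔞, RingOfIntegers.mapRingEquiv_apply, AlgEquiv.coe_ringEquiv]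

omit [NeZero m] in
/-- Scaling a tuple by a unit preserves «no `aᵢ = 0`» and «`Σ aᵢ = 0`». [folklore] -/
private theorem smul_facts {n : ℕ} (t : (ZMod m)ˣ) (a : Fin (n + 2) → ZMod m) (ha : ∀ i, a i ≠ 0)
    (hsum : ∑ i, a i = 0) :
    (∀ i, ((t : ZMod m) • a) i ≠ 0) ∧ ∑ i, ((t : ZMod m) • a) i = 0 := by
  refine ⟨fun i => ?_, ?_⟩
  · rw [Pi.smul_apply, smul_eq_mul]
    exact mt (Units.mul_right_eq_zero t).mp (ha i)
  · simp_rw [Pi.smul_apply, smul_eq_mul, ← mul_sum, hsum, mul_zero]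

/-- **(11) for Deligne's `J_a(𝔞)`**, `a ∈ X(S)` with no `aᵢ = 0`: `σ_t(J_a(𝔞)) = J_{ta}(𝔞)`.
[cite: Weil1952JacobiSums, §1 (11), p. 491] [cite: Deligne1982HodgeCycles, I §7 Rem. 7.17 (p. 55), Thm. 7.15 (c) («τ_u»)] -/
theorem mapRingEquiv_sigma_deligneJacobiIdeal (t : (ZMod m)ˣ) {n : ℕ} (a : Fin (n + 2) → ZMod m)
    (ha : ∀ i, a i ≠ 0) (hsum : ∑ i, a i = 0) (𝔞 : Ideal (𝓞 M)) :
    RingOfIntegers.mapRingEquiv (sigma m M t : M ≃+* M) (deligneJacobiIdeal a 𝔞) =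
      deligneJacobiIdeal ((t : ZMod m) • a) 𝔞 := by
  obtain ⟨hta, htsum⟩ := smul_facts t a ha hsum
  rw [deligneJacobiIdeal_eq_jacobiIdealR a (ha 0) hsum,
    deligneJacobiIdeal_eq_jacobiIdealR _ (hta 0) htsum, mapRingEquiv_sigma_jacobiIdealR]

/-- **`σ_t g(𝔞, a) = N𝔞^{⟨ta⟩ − ⟨a⟩} · g(𝔞, ta)`** for `a ∈ X(S)` with no `aᵢ = 0`, `t ∈ (ℤ/d)ˣ` and
`𝔞 ≠ 0` (`g(𝔞, a) = N𝔞^{1−⟨a⟩} J_a(𝔞)`, `N𝔞 ∈ ℚ` is fixed by `σ_t`, and (11)); the finite-field shadow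
is the tree's `FermatHodgeCharacterGaussSum.ringHom_apply_gaussValue_eq`.
[cite: Weil1952JacobiSums, §1 (11), p. 491] [cite: Deligne1982HodgeCycles, I §7 Rem. 7.17 (p. 55)] -/
theorem sigma_deligneG (t : (ZMod m)ˣ) {n : ℕ} (a : Fin (n + 2) → ZMod m) (ha : ∀ i, a i ≠ 0)
    (hsum : ∑ i, a i = 0) {𝔞 : Ideal (𝓞 M)} (h𝔞 : 𝔞 ≠ ⊥) :
    sigma m M t (deligneG a 𝔞) =
      ((Ideal.absNorm 𝔞 : ℕ) : M) ^ ((((∑ i, (((t : ZMod m) • a) i).val) / m : ℕ) : ℤ) -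
          (((∑ i, (a i).val) / m : ℕ) : ℤ)) * deligneG ((t : ZMod m) • a) 𝔞 := by
  have hN : ((Ideal.absNorm 𝔞 : ℕ) : M) ≠ 0 := by
    rw [Nat.cast_ne_zero, Ne, Ideal.absNorm_eq_zero_iff]
    exact h𝔞
  have hJ : sigma m M t (deligneJacobiIdeal a 𝔞 : M) = (deligneJacobiIdeal ((t : ZMod m) • a) 𝔞 : M) := by
    rw [← mapRingEquiv_sigma_deligneJacobiIdeal t a ha hsum, RingOfIntegers.mapRingEquiv_apply,
      AlgEquiv.coe_ringEquiv]
  rw [deligneG_def, deligneG_def, map_mul, map_zpow₀, map_natCast, hJ, ← mul_assoc, ← zpow_add₀ hN,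
    sub_add_sub_cancel']

/-- **`σ_t g(𝔞, a) = g(𝔞, ta)` under the hypothesis of Thm. 7.15** (`⟨ua⟩` independent of the unit `u`,
so `⟨ta⟩ = ⟨a⟩`; `𝔞 ≠ 0`): the values of Deligne's character at `ta` are the `τ_t`-conjugates of those
at `a` (cf. Thm. 7.15 (c) «`λ_{ua}(σ) = τ_u(λ_a(σ))`»).
[cite: Deligne1982HodgeCycles, I §7 Thm. 7.15 (c) (p. 54), Rem. 7.17 (p. 55)] [cite: Weil1952JacobiSums, §1 (11), p. 491] -/
theorem sigma_deligneG_of_const (t : (ZMod m)ˣ) {n : ℕ} (a : Fin (n + 2) → ZMod m)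
    (ha : ∀ i, a i ≠ 0) {c : ℕ} (hconst : ∀ u : (ZMod m)ˣ, ∑ i, ((u : ZMod m) * a i).val = m * c)
    {𝔞 : Ideal (𝓞 M)} (h𝔞 : 𝔞 ≠ ⊥) :
    sigma m M t (deligneG a 𝔞) = deligneG ((t : ZMod m) • a) 𝔞 := by
  have hsum : ∑ i, a i = 0 := sum_eq_zero_of_const a hconst
  have h1 : (∑ i, (a i).val) = m * c := by simpa using hconst 1
  have ht : (∑ i, (((t : ZMod m) • a) i).val) = m * c := by
    simpa only [Pi.smul_apply, smul_eq_mul] using hconst t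
  rw [sigma_deligneG t a ha hsum h𝔞, ht, h1, sub_self, zpow_zero, one_mul]

/-- The hypothesis of Thm. 7.15 is stable under `a ↦ ta`: no `(ta)ᵢ = 0` and `⟨u(ta)⟩ = ⟨(ut)a⟩` is the
same constant. [cite: Deligne1982HodgeCycles, I §7 Thm. 7.15 (c) (p. 54)] -/
theorem const_smul {n : ℕ} (t : (ZMod m)ˣ) (a : Fin (n + 2) → ZMod m) (ha : ∀ i, a i ≠ 0) {c : ℕ}
    (hconst : ∀ u : (ZMod m)ˣ, ∑ i, ((u : ZMod m) * a i).val = m * c) :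
    (∀ i, ((t : ZMod m) • a) i ≠ 0) ∧
      ∀ u : (ZMod m)ˣ, ∑ i, ((u : ZMod m) * ((t : ZMod m) • a) i).val = m * c := by
  refine ⟨(smul_facts t a ha (sum_eq_zero_of_const a hconst)).1, fun u => ?_⟩
  have h := hconst (u * t)
  simp only [Units.val_mul, mul_assoc] at h
  simpa only [Pi.smul_apply, smul_eq_mul] using h

end GaloisAction

/-! ### §4. `χ_{ta} = τ_t ∘ χ_a` -/

section Chi

variable {m : ℕ} [NeZero m] {M : Type} [Field M] [NumberField M] [hM : IsCyclotomicExtension {m} ℚ M]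

open GaloisRepresentations Field

/-- **`χ_{ta} = τ_t ∘ χ_a`** for Deligne's Galois characters (Rem. 7.17): under the hypothesis of
Thm. 7.15 (`m > 2`, no `aᵢ = 0`, `⟨ua⟩` constant) and for `t ∈ (ℤ/d)ˣ`, the character attached to `ta`
is the `τ_t`-conjugate of the one attached to `a` — by the UNIQUENESS of `χ_{ta}` (`eq_deligneChi`):
`τ_t ∘ χ_a` has open kernel and takes the value `τ_t(g(𝔭, a)) = g(𝔭, ta)` (Weil's (11),
`sigma_deligneG_of_const`) at every geometric Frobenius above every `𝔭 ∤ d`.  This is the Galois-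
character form of Thm. 7.15 (c) «`λ_{ua}(σ) = τ_u(λ_a(σ))`».
[cite: Deligne1982HodgeCycles, I §7 Thm. 7.15 (c) (p. 54), Rem. 7.17 (p. 55)] [cite: Weil1952JacobiSums, §1 (11), p. 491] -/
theorem deligneChi_smul (hm2 : 2 < m) (t : (ZMod m)ˣ) {n : ℕ} (a : Fin (n + 2) → ZMod m)
    (ha : ∀ i, a i ≠ 0) {c : ℕ} (hconst : ∀ u : (ZMod m)ˣ, ∑ i, ((u : ZMod m) * a i).val = m * c) :
    deligneChi M ((t : ZMod m) • a) =
      (Units.map ((sigma m M t : M ≃ₐ[ℚ] M) : M →* M)).comp (deligneChi M a) := by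
  obtain ⟨hta, hconst'⟩ := const_smul t a ha hconst
  symm
  refine eq_deligneChi hm2 _ hta hconst' ?_ fun v hv 𝔓 h𝔓 F hF => ?_
  · refine Subgroup.isOpen_mono (fun σ hσ => ?_) (isOpen_ker_deligneChi a)
    rw [MonoidHom.mem_ker] at hσ ⊢
    rw [MonoidHom.comp_apply, hσ, map_one]
  · rw [MonoidHom.comp_apply, Units.coe_map, MonoidHom.coe_coe,
      deligneChi_geomFrob hm2 a ha hconst hv h𝔓 hF]
    exact sigma_deligneG_of_const t a ha hconst v.ne_bot

/-- Pointwise: `χ_{ta}(σ) = τ_t(χ_a(σ))` in `k^×`. [cite: Deligne1982HodgeCycles, I §7 Thm. 7.15 (c) (p. 54), Rem. 7.17 (p. 55)] -/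
theorem coe_deligneChi_smul_apply (hm2 : 2 < m) (t : (ZMod m)ˣ) {n : ℕ} (a : Fin (n + 2) → ZMod m)
    (ha : ∀ i, a i ≠ 0) {c : ℕ} (hconst : ∀ u : (ZMod m)ˣ, ∑ i, ((u : ZMod m) * a i).val = m * c)
    (σ : absoluteGaloisGroup M) :
    ((deligneChi M ((t : ZMod m) • a) σ : Mˣ) : M) = sigma m M t ((deligneChi M a σ : Mˣ) : M) := by
  rw [deligneChi_smul hm2 t a ha hconst, MonoidHom.comp_apply, Units.coe_map, MonoidHom.coe_coe]

end Chi

/-! ### §5. Weil's (10): `|J_a(𝔞)|² = N𝔞^{s−2}` for every `r` -/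

section AbsoluteValue

variable {m : ℕ} [NeZero m] {M : Type*} [Field M] [NumberField M] [hM : IsCyclotomicExtension {m} ℚ M]

/-- `σ_{−1} ζ = ζ^{(−1).val}` (the hypothesis `hτ` of the tree's `map_coe_jacobiIdeal` for `t = −1`). [folklore] -/
private theorem sigma_neg_one_zeta_pow :
    (sigma m M (-1) : M →+* M) (zeta m ℚ M) = zeta m ℚ M ^ ((-1 : ZMod m)).val := by
  have h := sigma_zeta (M := M) (-1 : (ZMod m)ˣ)
  rw [Units.val_neg, Units.val_one] at h
  exact h

/-- `σ_{−1}(J(b, 𝔞)) = J(−b, 𝔞)` for pairs ((11) with `t = −1`, tree `map_coe_jacobiIdeal`).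
[cite: Weil1952JacobiSums, §1 (11), p. 491] -/
theorem sigma_neg_one_coe_jacobiIdeal (b : Fin 2 → ZMod m) (𝔞 : Ideal (𝓞 M)) :
    (sigma m M (-1) : M →+* M) (jacobiIdeal b 𝔞 : M) = (jacobiIdeal (-b) 𝔞 : M) := by
  rw [map_coe_jacobiIdeal (sigma m M (-1) : M →+* M) sigma_neg_one_zeta_pow b 𝔞]
  congr 2
  funext i
  simp only [Pi.smul_apply, smul_eq_mul, neg_one_mul, Pi.neg_apply]

/-- **(10) for a non-special pair**: `J(b, 𝔞) · J(−b, 𝔞) = N𝔞` (`J(−b, 𝔞) = σ_{−1}J(b, 𝔞)` is the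
complex conjugate; tree `coe_jacobiIdeal_mul_map_eq_absNorm`). [cite: Weil1952JacobiSums, §1 (10), p. 490] [cite: Lang1990, Ch. 1 §1 GS 2, §4 (J 2)] -/
theorem coe_jacobiIdeal_mul_neg {𝔞 : Ideal (𝓞 M)} (h𝔞 : 𝔞 ≠ ⊥)
    (h𝔞m : ∀ 𝔭 ∈ normalizedFactors 𝔞, (m : 𝓞 M) ∉ 𝔭) (b : Fin 2 → ZMod m) (hb0 : b 0 ≠ 0)
    (hb1 : b 1 ≠ 0) (hb : b 0 + b 1 ≠ 0) :
    (jacobiIdeal b 𝔞 : M) * (jacobiIdeal (-b) 𝔞 : M) = Ideal.absNorm 𝔞 := by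
  rw [← sigma_neg_one_coe_jacobiIdeal b 𝔞]
  exact coe_jacobiIdeal_mul_map_eq_absNorm h𝔞 h𝔞m _ (by
    rw [RingHom.coe_coe]; exact sigma_neg_one_zeta) b hb0 hb1 hb

/-- **(10) for a special pair `b = (t, −t)`, `t ≠ 0`**: `J(b, 𝔞) · J(−b, 𝔞) = 1` (`J(b, 𝔞) = ±1` is fixed
by `σ_{−1}`). [cite: Weil1952JacobiSums, §1 (10), p. 490 (s = 2)] [cite: Lang1990, Ch. 1 §4 («J(a, 𝔞) = 1 or −1»)] -/
theorem coe_jacobiIdeal_mul_neg_of_isSpecial {b : Fin 2 → ZMod m} (hb : IsSpecial b) (hb0 : b ≠ 0)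
    (𝔞 : Ideal (𝓞 M)) : (jacobiIdeal b 𝔞 : M) * (jacobiIdeal (-b) 𝔞 : M) = 1 := by
  have h2 := coe_jacobiIdeal_sq_of_isSpecial hb hb0 𝔞
  rw [← sigma_neg_one_coe_jacobiIdeal b 𝔞]
  rcases mul_self_eq_one_iff.mp ((sq _).symm.trans h2) with h | h
  · rw [h, map_one, mul_one]
  · rw [h, map_neg, map_one, neg_mul_neg, mul_one]

omit [NeZero m] hM in
/-- `![(−a)₀, (−a)₁] = −![a₀, a₁]`. [folklore] -/
private theorem vec_neg {k : ℕ} (a : Fin (k + 2) → ZMod m) : (![(-a) 0, (-a) 1] : Fin 2 → ZMod m) = -![a 0, a 1] := by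
  funext i
  fin_cases i <;> rfl

omit [NeZero m] hM in
/-- `Fin.cons ((−a)₀ + (−a)₁) (tail² (−a)) = −Fin.cons (a₀ + a₁) (tail² a)`. [folklore] -/
private theorem cons_tail_neg {k : ℕ} (a : Fin (k + 2) → ZMod m) :
    (Fin.cons ((-a) 0 + (-a) 1) (Fin.tail (Fin.tail (-a))) : Fin (k + 1) → ZMod m) =
      -(Fin.cons (a 0 + a 1) (Fin.tail (Fin.tail a)) : Fin (k + 1) → ZMod m) := by
  funext j
  refine Fin.cases ?_ (fun i => ?_) j
  · simp only [Fin.cons_zero, Pi.neg_apply, neg_add]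
  · simp only [Fin.cons_succ, Pi.neg_apply, Fin.tail]

/-- **Weil 1952 (10) «`|J_a(𝔞)|² = N𝔞^{s−2}`» for EVERY `r`, algebraic form.**  For `𝔞 ≠ 0` prime to `m`
and `a ∈ (ℤ/m)^{r+1}` with NO `a_ρ ≡ 0` (Weil's `s` = number of nonzero entries among `a_ρ`, `Σ a_ρ`,
here `s = r + 1 + [Σ a_ρ ≢ 0]`): `J_a(𝔞) · J_{−a}(𝔞) = N𝔞^{s−2}` in `ℚ(μ_m)` — and `J_{−a}(𝔞) = σ_{−1}J_a(𝔞)`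
is the complex conjugate ((11)).  PROOF: Weil's induction on `r` (p. 492): for the second relation the
non-special pair contributes `N𝔞` (`coe_jacobiIdeal_mul_neg`) and `s` drops by one; for the first relation
the special pair contributes `1`, the factor `N𝔞` appears squared and `s` drops by two.
[cite: Weil1952JacobiSums, §1 (10), p. 490–491; p. 492] -/
theorem coe_jacobiIdealR_mul_neg_eq_absNorm_pow {𝔞 : Ideal (𝓞 M)} (h𝔞 : 𝔞 ≠ ⊥)
    (h𝔞m : ∀ 𝔭 ∈ normalizedFactors 𝔞, (m : 𝓞 M) ∉ 𝔭) {r : ℕ} (a : Fin (r + 1) → ZMod m)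
    (ha : ∀ ρ, a ρ ≠ 0) :
    (jacobiIdealR a 𝔞 : M) * (jacobiIdealR (-a) 𝔞 : M) =
      ((Ideal.absNorm 𝔞 : ℕ) : M) ^ (r + 1 + (if ∑ ρ, a ρ = 0 then 0 else 1) - 2) := by
  classical
  induction r using Nat.strong_induction_on with
  | _ r ih =>
  rcases r with _ | _ | k
  · -- one exponent: `J = 1`, `Σ a_ρ = a₁ ≢ 0`, `s = 2`
    have hι : (∑ ρ, a ρ) ≠ 0 := by rw [Fin.sum_univ_one]; exact ha 0
    rw [if_neg hι, jacobiIdealR_fin_one, jacobiIdealR_fin_one]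
    norm_num
  · -- a pair
    have ha2 : a = ![a 0, a 1] := by funext ρ; fin_cases ρ <;> rfl
    have hneg : -a = ![(-a) 0, (-a) 1] := by funext ρ; fin_cases ρ <;> rfl
    rw [jacobiIdealR_fin_two, jacobiIdealR_fin_two, hneg, vec_neg, ← ha2]
    by_cases hs : a 0 + a 1 = 0
    · have hι : (∑ ρ, a ρ) = 0 := by rw [Fin.sum_univ_two, hs]
      have ha0 : a ≠ 0 := fun h => ha 0 (congrFun h 0)
      rw [if_pos hι, coe_jacobiIdeal_mul_neg_of_isSpecial (Or.inr (Or.inr hs)) ha0 𝔞]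
      norm_num
    · have hι : (∑ ρ, a ρ) ≠ 0 := by rwa [Fin.sum_univ_two]
      rw [if_neg hι, coe_jacobiIdeal_mul_neg h𝔞 h𝔞m a (ha 0) (ha 1) hs]
      norm_num
  · -- `r + 1 = k + 3` exponents
    have hneg0 : (-a) 0 ≠ 0 := by rw [Pi.neg_apply, neg_ne_zero]; exact ha 0
    by_cases hs : a 0 + a 1 = 0
    · -- first relation, for `a` and for `−a`
      have hs' : (-a) 0 + (-a) 1 = 0 := by rw [Pi.neg_apply, Pi.neg_apply, ← neg_add, hs, neg_zero]
      have hb0 : a (0 : Fin (k + 1)).succ.succ ≠ 0 := ha _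
      have hb0' : (-a) (0 : Fin (k + 1)).succ.succ ≠ 0 := by rw [Pi.neg_apply, neg_ne_zero]; exact ha _
      set b : Fin (k + 1) → ZMod m := Fin.tail (Fin.tail a) with hb
      have hbne : ∀ ρ, b ρ ≠ 0 := fun ρ => ha _
      have htail : Fin.tail (Fin.tail (-a)) = -b := rfl
      have hι : (∑ ρ, a ρ) = ∑ i, b i := by
        rw [sum_univ_add_two', hs, zero_add, hb]
        rfl
      have hspec : IsSpecial ![a 0, a 1] := Or.inr (Or.inr (by simpa using hs))
      have hne0 : (![a 0, a 1] : Fin 2 → ZMod m) ≠ 0 := fun h => ha 0 (by simpa using congrFun h 0)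
      have hih := ih k (by omega) b hbne
      have htwo : 2 ≤ k + 1 + (if ∑ i, b i = 0 then 0 else 1) := by
        rcases k with _ | k'
        · have : (∑ i, b i) ≠ 0 := by rw [Fin.sum_univ_one]; exact hbne 0
          rw [if_neg this]
        · split_ifs <;> omega
      rw [jacobiIdealR_eq_mul_absNorm_mul_of_add_eq_zero a (ha 0) hs hb0 h𝔞 h𝔞m,
        jacobiIdealR_eq_mul_absNorm_mul_of_add_eq_zero (-a) hneg0 hs' hb0' h𝔞 h𝔞m, htail, vec_neg, hι]
      push_cast
      have key : (jacobiIdeal ![a 0, a 1] 𝔞 : M) * (Ideal.absNorm 𝔞 : M) * (jacobiIdealR b 𝔞 : M) *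
          ((jacobiIdeal (-![a 0, a 1]) 𝔞 : M) * (Ideal.absNorm 𝔞 : M) * (jacobiIdealR (-b) 𝔞 : M)) =
          ((jacobiIdeal ![a 0, a 1] 𝔞 : M) * (jacobiIdeal (-![a 0, a 1]) 𝔞 : M)) *
            (Ideal.absNorm 𝔞 : M) ^ 2 * ((jacobiIdealR b 𝔞 : M) * (jacobiIdealR (-b) 𝔞 : M)) := by ring
      rw [key, coe_jacobiIdeal_mul_neg_of_isSpecial hspec hne0 𝔞, one_mul, hih, ← pow_add]
      congr 1
      omega
    · -- second relation, for `a` and for `−a`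
      have hs' : (-a) 0 + (-a) 1 ≠ 0 := by
        rw [Pi.neg_apply, Pi.neg_apply, ← neg_add, neg_ne_zero]; exact hs
      set a'' : Fin (k + 2) → ZMod m := Fin.cons (a 0 + a 1) (Fin.tail (Fin.tail a)) with ha''
      have ha''0 : ∀ ρ, a'' ρ ≠ 0 := fun ρ => by
        refine Fin.cases ?_ (fun i => ?_) ρ
        · simpa [ha''] using hs
        · simp only [ha'', Fin.cons_succ, Fin.tail]
          exact ha _
      have hι : (∑ ρ, a ρ) = ∑ j, a'' j := by
        rw [Fin.sum_univ_succ (f := a''), sum_univ_add_two']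
        simp only [ha'', Fin.cons_zero, Fin.cons_succ, Fin.tail]
      have hih := ih (k + 1) (by omega) a'' ha''0
      rw [jacobiIdealR_eq_mul_of_add_ne_zero a hs 𝔞, jacobiIdealR_eq_mul_of_add_ne_zero (-a) hs' 𝔞,
        cons_tail_neg, vec_neg, hι]
      push_cast
      have key : (jacobiIdeal ![a 0, a 1] 𝔞 : M) * (jacobiIdealR a'' 𝔞 : M) *
          ((jacobiIdeal (-![a 0, a 1]) 𝔞 : M) * (jacobiIdealR (-a'') 𝔞 : M)) =
          ((jacobiIdeal ![a 0, a 1] 𝔞 : M) * (jacobiIdeal (-![a 0, a 1]) 𝔞 : M)) *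
            ((jacobiIdealR a'' 𝔞 : M) * (jacobiIdealR (-a'') 𝔞 : M)) := by ring
      rw [key, coe_jacobiIdeal_mul_neg h𝔞 h𝔞m _ (by simpa using ha 0) (by simpa using ha 1)
        (by simpa using hs), hih, ← pow_succ']
      congr 1
      split_ifs <;> omega

/-- **(10) for Deligne's tuples**: for `a ∈ X(S)` (`Σ aᵢ = 0`) with no `aᵢ = 0` (`s = n + 2`),
`J_a(𝔞) · J_{−a}(𝔞) = N𝔞ⁿ` — Deligne's `J_a` (as an eigenvalue of Frobenius on `Hⁿ`, Prop. 7.10) has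
weight `n`. [cite: Weil1952JacobiSums, §1 (10), p. 490] [cite: Deligne1982HodgeCycles, I §7 Prop. 7.10, Rem. 7.17] -/
theorem coe_deligneJacobiIdeal_mul_neg {𝔞 : Ideal (𝓞 M)} (h𝔞 : 𝔞 ≠ ⊥)
    (h𝔞m : ∀ 𝔭 ∈ normalizedFactors 𝔞, (m : 𝓞 M) ∉ 𝔭) {n : ℕ} (a : Fin (n + 2) → ZMod m)
    (ha : ∀ i, a i ≠ 0) (hsum : ∑ i, a i = 0) :
    (deligneJacobiIdeal a 𝔞 : M) * (deligneJacobiIdeal (-a) 𝔞 : M) = ((Ideal.absNorm 𝔞 : ℕ) : M) ^ n := by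
  have hneg : ∀ i, (-a) i ≠ 0 := fun i => by rw [Pi.neg_apply, neg_ne_zero]; exact ha i
  have hnsum : ∑ i, (-a) i = 0 := by simp only [Pi.neg_apply, sum_neg_distrib, hsum, neg_zero]
  rw [deligneJacobiIdeal_eq_jacobiIdealR a (ha 0) hsum, deligneJacobiIdeal_eq_jacobiIdealR _ (hneg 0) hnsum,
    coe_jacobiIdealR_mul_neg_eq_absNorm_pow h𝔞 h𝔞m a ha, if_pos hsum]
  rfl

/-- **Weil 1952 (10), COMPLEX FORM: `|φ(J_a(𝔞))|² = N𝔞^{s−2}`** under every complex embedding `φ` of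
`ℚ(μ_m)` (no `a_ρ ≡ 0`; `s = r + 1 + [Σ a_ρ ≢ 0]`): «all the conjugates of `J_a(𝔞)` have that same
absolute value» — complex conjugation is `σ_{−1}` (tree `conjugate_eq_comp_sigma_neg_one`) and
`σ_{−1}J_a(𝔞) = J_{−a}(𝔞)` ((11)). [cite: Weil1952JacobiSums, §1 (10)–(11), p. 490–491] -/
theorem norm_map_jacobiIdealR_sq (φ : M →+* ℂ) {𝔞 : Ideal (𝓞 M)} (h𝔞 : 𝔞 ≠ ⊥)
    (h𝔞m : ∀ 𝔭 ∈ normalizedFactors 𝔞, (m : 𝓞 M) ∉ 𝔭) {r : ℕ} (a : Fin (r + 1) → ZMod m)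
    (ha : ∀ ρ, a ρ ≠ 0) :
    ‖φ (jacobiIdealR a 𝔞 : M)‖ ^ 2 =
      (Ideal.absNorm 𝔞 : ℝ) ^ (r + 1 + (if ∑ ρ, a ρ = 0 then 0 else 1) - 2) := by
  have hconj : starRingEnd ℂ (φ (jacobiIdealR a 𝔞 : M)) = φ (jacobiIdealR (-a) 𝔞 : M) := by
    rw [← ComplexEmbedding.conjugate_coe_eq, conjugate_eq_comp_sigma_neg_one (m := m) φ, RingHom.comp_apply,
      RingHom.coe_coe, sigma_coe_jacobiIdealR]
    congr 3
    funext i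
    simp only [Pi.smul_apply, smul_eq_mul, Units.val_neg, Units.val_one, neg_one_mul, Pi.neg_apply]
  have h := congrArg φ (coe_jacobiIdealR_mul_neg_eq_absNorm_pow h𝔞 h𝔞m a ha)
  rw [map_mul, ← hconj, Complex.mul_conj, map_pow, map_natCast] at h
  rw [Complex.sq_norm]
  exact_mod_cast h

/-- **The weight of Deligne's `g(𝔞, a)`**: for `a ∈ X(S)` with no `aᵢ = 0`, `𝔞 ≠ 0` prime to `d`, and every
complex embedding `φ` of `k`: `|φ(g(𝔞, a))|² = N𝔞^{n+2−2⟨a⟩}` (`g = N𝔞^{1−⟨a⟩}J_a`, `|J_a|² = N𝔞ⁿ`); under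
the hypothesis of Thm. 7.15 (`2⟨a⟩ = n + 2`) this is `1` (tree `norm_map_deligneG_eq_one`).
[cite: Deligne1982HodgeCycles, I §7 Prop. 7.10 («F acts as q^{⟨a⟩−1} g(𝔭, a)»), proof of Thm. 7.15 («has absolute value 1»)] [cite: Weil1952JacobiSums, §1 (10), p. 490] -/
theorem norm_map_deligneG_sq (φ : M →+* ℂ) {𝔞 : Ideal (𝓞 M)} (h𝔞 : 𝔞 ≠ ⊥)
    (h𝔞m : ∀ 𝔭 ∈ normalizedFactors 𝔞, (m : 𝓞 M) ∉ 𝔭) {n : ℕ} (a : Fin (n + 2) → ZMod m)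
    (ha : ∀ i, a i ≠ 0) (hsum : ∑ i, a i = 0) :
    ‖φ (deligneG a 𝔞)‖ ^ 2 =
      (Ideal.absNorm 𝔞 : ℝ) ^ ((n : ℤ) + 2 - 2 * (((∑ i, (a i).val) / m : ℕ) : ℤ)) := by
  have hN : (Ideal.absNorm 𝔞 : ℝ) ≠ 0 := by
    rw [Nat.cast_ne_zero, Ne, Ideal.absNorm_eq_zero_iff]
    exact h𝔞
  have hJ : ‖φ (deligneJacobiIdeal a 𝔞 : M)‖ ^ 2 = (Ideal.absNorm 𝔞 : ℝ) ^ n := by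
    have h := norm_map_jacobiIdealR_sq φ h𝔞 h𝔞m a ha
    rw [if_pos hsum] at h
    rw [deligneJacobiIdeal_eq_jacobiIdealR a (ha 0) hsum, h]
    congr 1
  rw [deligneG_def, map_mul, norm_mul, mul_pow, map_zpow₀, map_natCast, norm_zpow, Complex.norm_natCast,
    hJ, ← zpow_natCast, ← zpow_mul, ← zpow_natCast, ← zpow_add₀ hN]
  congr 1
  push_cast
  ring

end AbsoluteValue

/-! ### §6. Principal ideals — Weil (12): «`ε(a) = J_a((α)) α^{−ω(a)}` … is a unit … `ε(a)` and all
its conjugates have the absolute value `1` … a root of unity», for every `r` -/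

section Principal

/-- `σ⁻¹(α) = (σ̃⁻¹ α)`: the contraction of a principal ideal along `σ̃ = mapRingEquiv σ`. [folklore] -/
private theorem comap_mapRingEquiv_span_singleton' (σ : M ≃ₐ[ℚ] M) (α : 𝓞 M) :
    (Ideal.span {α}).comap (RingOfIntegers.mapRingEquiv (σ : M ≃+* M)) =
      Ideal.span {(RingOfIntegers.mapRingEquiv (σ : M ≃+* M)).symm α} := by
  rw [← Ideal.map_symm, Ideal.map_span, Set.image_singleton]

/-- Weil's symbolic power `α^θ = ∏_c (σ_c⁻¹ α)^{θ_c}` (`galPow`), re-indexed by `σ ∈ Gal(ℚ(μ_m)/ℚ)`: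
`α^θ = ∏_σ (σ̃⁻¹ α)^{θ_{c(σ)}}` in `M`, for any exponent vector `θ` on `ℤ/m` (the tree's
`galPow_sigma_thetaCoeff_eq` is the case `θ = θ[a]`, `r = 2`).
[cite: Weil1952JacobiSums, §1 (8)–(9), (12), p. 490–491] [cite: Lang1990, Ch. 1 §4 (α^{θ[a]}, w(a, α))] -/
theorem galPow_sigma_eq_coe_prod (θ : ZMod m → ℕ) (α : 𝓞 M) :
    galPow (sigma m M) (fun c => θ (c : ZMod m)) (α : M) =
      ((∏ σ : M ≃ₐ[ℚ] M, (RingOfIntegers.mapRingEquiv (σ : M ≃+* M)).symm α ^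
        θ ((Rat.galEquivZMod m M σ : (ZMod m)ˣ) : ZMod m) : 𝓞 M) : M) := by
  rw [galPow_def, show (((∏ σ : M ≃ₐ[ℚ] M, (RingOfIntegers.mapRingEquiv (σ : M ≃+* M)).symm α ^
      θ ((Rat.galEquivZMod m M σ : (ZMod m)ˣ) : ZMod m) : 𝓞 M) : M)) =
      algebraMap (𝓞 M) M (∏ σ : M ≃ₐ[ℚ] M, (RingOfIntegers.mapRingEquiv (σ : M ≃+* M)).symm α ^
      θ ((Rat.galEquivZMod m M σ : (ZMod m)ˣ) : ZMod m)) from rfl, map_prod]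
  refine Fintype.prod_equiv (Rat.galEquivZMod m M).symm.toEquiv _ _ fun c => ?_
  have hc : Rat.galEquivZMod m M ((Rat.galEquivZMod m M).symm c) = c :=
    MulEquiv.apply_symm_apply _ c
  rw [map_pow]
  change (sigma m M c⁻¹) (α : M) ^ _ = _
  rw [MulEquiv.toEquiv_eq_coe, MulEquiv.coe_toEquiv, hc, map_inv]
  congr 1

/-- **(8) for a principal ideal, every `r`**: for `α ≠ 0` prime to `m` and `a ≠ 0`,
`(J_a((α))) = (∏_σ (σ̃⁻¹ α)^{ω(a)_{c(σ)}})` — the principal ideal generated by `α^{ω(a)}`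
(the tree's `span_jacobiIdeal_span_eq` is `r = 2`). [cite: Weil1952JacobiSums, §1 (8), (12), p. 490–491] -/
theorem span_jacobiIdealR_span_singleton_eq {α : 𝓞 M} (hα0 : α ≠ 0)
    (hα : IsCoprime (Ideal.span {α}) (Ideal.span {(m : 𝓞 M)})) {r : ℕ} (a : Fin r → ZMod m)
    (ha : a ≠ 0) :
    Ideal.span {jacobiIdealR a (Ideal.span {α})} =
      Ideal.span {∏ σ : M ≃ₐ[ℚ] M, (RingOfIntegers.mapRingEquiv (σ : M ≃+* M)).symm α ^
        omegaCoeff a ((Rat.galEquivZMod m M σ : (ZMod m)ˣ) : ZMod m)} := by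
  rw [span_jacobiIdealR_eq_prod_comap_pow (by rwa [Ne, Ideal.span_singleton_eq_bot])
    (not_mem_of_mem_normalizedFactors_span hα) a ha, ← Ideal.prod_span_singleton]
  simp_rw [← Ideal.span_singleton_pow, comap_mapRingEquiv_span_singleton']

/-- `J_a((α))` and `∏_σ (σ̃⁻¹ α)^{ω(a)_{c(σ)}}` (`= α^{ω(a)}`) are associated in `𝓞 ℚ(μ_m)`, every `r`
(«by (8), `ε(a)` is a unit»). [cite: Weil1952JacobiSums, §1 (8), (12), p. 490–491] -/
theorem associated_jacobiIdealR {α : 𝓞 M} (hα0 : α ≠ 0)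
    (hα : IsCoprime (Ideal.span {α}) (Ideal.span {(m : 𝓞 M)})) {r : ℕ} (a : Fin r → ZMod m)
    (ha : a ≠ 0) :
    Associated (jacobiIdealR a (Ideal.span {α}))
      (∏ σ : M ≃ₐ[ℚ] M, (RingOfIntegers.mapRingEquiv (σ : M ≃+* M)).symm α ^
        omegaCoeff a ((Rat.galEquivZMod m M σ : (ZMod m)ˣ) : ZMod m)) :=
  Ideal.span_singleton_eq_span_singleton.mp (span_jacobiIdealR_span_singleton_eq hα0 hα a ha)

/-- **Weil (12), the unit `ε(a)`, every `r`**: «`ε(a) = J_a((α)) α^{−ω(a)}`. Then, by (8), `ε(a)` is a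
unit in `Q(ζ)`»: for `α ≠ 0` prime to `m` and `a ∈ (ℤ/m)^r`, `a ≠ 0`, there is a unit `ε` of `𝓞 ℚ(μ_m)`
with `J_a((α)) = ε · α^{ω(a)}` (`α^{ω(a)} = galPow σ ω(a) α = ∏_c (σ_c⁻¹ α)^{ω(a)_c}`; the tree's
`exists_unit_jacobiIdeal_eq` is `r = 2`, and `ε = 1` when `α ≡ 1 (mod m²)`:
`coe_jacobiIdealR_span_singleton_eq_galPow`). [cite: Weil1952JacobiSums, §1 (12), p. 491] -/
theorem exists_unit_jacobiIdealR_eq {α : 𝓞 M} (hα0 : α ≠ 0)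
    (hα : IsCoprime (Ideal.span {α}) (Ideal.span {(m : 𝓞 M)})) {r : ℕ} (a : Fin r → ZMod m)
    (ha : a ≠ 0) :
    ∃ ε : (𝓞 M)ˣ, (jacobiIdealR a (Ideal.span {α}) : M) =
      (ε : 𝓞 M) * galPow (sigma m M) (fun c => omegaCoeff a (c : ZMod m)) (α : M) := by
  obtain ⟨w, hw⟩ := (associated_jacobiIdealR hα0 hα a ha).symm
  refine ⟨w, ?_⟩
  rw [galPow_sigma_eq_coe_prod (omegaCoeff a), ← hw]
  push_cast
  ring

omit hM in
/-- **`ω(a)(1 + σ_{−1}) = (s − 2) Σ_t σ_t`**: for `a ∈ (ℤ/m)^{r+1}` with no `a_ρ ≡ 0` and every unit `c`,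
`ω(a)_c + ω(a)_{−c} = s − 2` with `s = r + 1 + [Σ a_ρ ≢ 0]` («the conjugate imaginary to `β^ω` is
`β^{ωσ_{−1}}`, so that `|β^ω|² = β^{ω+ωσ_{−1}}`; using (6) and (9), one finds at once that all conjugates of
`α^{ω(a)}` have the absolute value `N(α)^{(s−2)/2}`»; (6) is `θ(t)(1 + σ_{−1}) = Σ_t σ_t` for `t ≢ 0`,
here `⟨x⟩ + ⟨−x⟩ = m`). [cite: Weil1952JacobiSums, §1 (6), (9), p. 490–491] -/
theorem omegaCoeff_add_omegaCoeff_neg {r : ℕ} (a : Fin (r + 1) → ZMod m) (ha : ∀ ρ, a ρ ≠ 0)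
    (c : (ZMod m)ˣ) :
    omegaCoeff a (c : ZMod m) + omegaCoeff a ((-c : (ZMod m)ˣ) : ZMod m) =
      r + 1 + (if ∑ ρ, a ρ = 0 then 0 else 1) - 2 := by
  have hm0 : 0 < m := NeZero.pos m
  have hAB : ∑ ρ, (a ρ * (c : ZMod m)).val + ∑ ρ, (a ρ * ((-c : (ZMod m)ˣ) : ZMod m)).val =
      (r + 1) * m := by
    rw [← sum_add_distrib]
    have h : ∀ ρ, (a ρ * (c : ZMod m)).val + (a ρ * ((-c : (ZMod m)ˣ) : ZMod m)).val = m :=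
      fun ρ => by
        rw [Units.val_neg, mul_neg]
        exact val_add_val_neg' (mt (Units.mul_left_eq_zero c).mp (ha ρ))
    simp_rw [h, sum_const, card_univ, Fintype.card_fin, smul_eq_mul]
  have hmodc : ∀ u : (ZMod m)ˣ, ((∑ ρ, (a ρ * (u : ZMod m)).val : ℕ) : ZMod m) =
      (∑ ρ, a ρ) * (u : ZMod m) := fun u => by
    rw [Nat.cast_sum]
    simp_rw [ZMod.natCast_zmod_val]
    rw [← sum_mul]
  by_cases hsum : ∑ ρ, a ρ = 0
  · have hdvd : m ∣ ∑ ρ, (a ρ * (c : ZMod m)).val := by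
      rw [← ZMod.natCast_eq_zero_iff, hmodc, hsum, zero_mul]
    have ha' : a ≠ 0 := fun h => ha 0 (congrFun h 0)
    have h1 := one_le_sum_val_div a ha' hsum c
    have h2 := one_le_sum_val_div a ha' hsum (-c)
    have hq : (∑ ρ, (a ρ * (c : ZMod m)).val) / m +
        (∑ ρ, (a ρ * ((-c : (ZMod m)ˣ) : ZMod m)).val) / m = r + 1 := by
      rw [← Nat.add_div_of_dvd_right hdvd, hAB, Nat.mul_div_cancel _ hm0]
    rw [omegaCoeff_def, omegaCoeff_def, if_pos hsum, if_pos hsum]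
    omega
  · have hndvd : ¬ m ∣ ∑ ρ, (a ρ * (c : ZMod m)).val := by
      rw [← ZMod.natCast_eq_zero_iff, hmodc]
      exact mt (Units.mul_left_eq_zero c).mp hsum
    rw [omegaCoeff_def, omegaCoeff_def, if_neg hsum, if_neg hsum, Nat.sub_zero, Nat.sub_zero]
    generalize hA : ∑ ρ, (a ρ * (c : ZMod m)).val = A at hAB hndvd ⊢
    generalize hB : ∑ ρ, (a ρ * ((-c : (ZMod m)ˣ) : ZMod m)).val = B at hAB ⊢
    have hmod : (A % m + B % m) % m = 0 := by rw [← Nat.add_mod, hAB, Nat.mul_mod_left]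
    have hApos : 0 < A % m := Nat.pos_of_ne_zero fun h => hndvd (Nat.dvd_of_mod_eq_zero h)
    have hle : m ≤ A % m + B % m :=
      Nat.le_of_dvd (lt_of_lt_of_le hApos (Nat.le_add_right _ _)) (Nat.dvd_of_mod_eq_zero hmod)
    have hq : A / m + B / m + 1 = r + 1 := by
      rw [← Nat.add_div_eq_of_le_mod_add_mod hle hm0, hAB, Nat.mul_div_cancel _ hm0]
    omega

/-- `α^θ · σ_{−1}(α^θ) = (∏_c σ_c α)^k` when `θ_c + θ_{−c} = k` for every `c` (the tree's
`galPow_mul_map_galPow` is `k = 1`): «`|β^ω|² = β^{ω + ωσ_{−1}}`». [cite: Weil1952JacobiSums, §1 p. 491] -/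
private theorem galPow_mul_sigma_neg_one_galPow {θ : (ZMod m)ˣ → ℕ} {k : ℕ}
    (hθ : ∀ c, θ c + θ (-c) = k) (x : M) :
    galPow (sigma m M) θ x * sigma m M (-1) (galPow (sigma m M) θ x) =
      (∏ c, sigma m M c x) ^ k := by
  rw [map_galPow_neg_one, galPow_def, ← prod_mul_distrib, ← prod_pow]
  simp_rw [← pow_add, hθ]
  exact Fintype.prod_equiv (Equiv.inv (ZMod m)ˣ) _ _ fun c => by simp

/-- **«all conjugates of `α^{ω(a)}` have the absolute value `N(α)^{(s−2)/2}`»** (`m > 2`, `α ≠ 0`,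
no `a_ρ ≡ 0`, `s = r + 1 + [Σ a_ρ ≢ 0]`): `|φ(α^{ω(a)})|² = N((α))^{s−2}` for every complex embedding
`φ` («As the field `Q(ζ)` is purely imaginary, there is no distinction to be made between the norms of
the number `α` and of the principal ideal `(α)`»). [cite: Weil1952JacobiSums, §1 (6), (9), (12), p. 491] -/
theorem norm_map_galPow_omegaCoeff_sq (hm2 : 2 < m) (φ : M →+* ℂ) {α : 𝓞 M} (hα0 : α ≠ 0) {r : ℕ}
    (a : Fin (r + 1) → ZMod m) (ha : ∀ ρ, a ρ ≠ 0) :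
    ‖φ (galPow (sigma m M) (fun c => omegaCoeff a (c : ZMod m)) (α : M))‖ ^ 2 =
      (Ideal.absNorm (Ideal.span {α}) : ℝ) ^ (r + 1 + (if ∑ ρ, a ρ = 0 then 0 else 1) - 2) := by
  have hconj : starRingEnd ℂ (φ (galPow (sigma m M) (fun c => omegaCoeff a (c : ZMod m)) (α : M))) =
      φ (sigma m M (-1) (galPow (sigma m M) (fun c => omegaCoeff a (c : ZMod m)) (α : M))) := by
    rw [← ComplexEmbedding.conjugate_coe_eq, conjugate_eq_comp_sigma_neg_one (m := m) φ,
      RingHom.comp_apply, RingHom.coe_coe]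
  have h := galPow_mul_sigma_neg_one_galPow (M := M) (θ := fun c => omegaCoeff a (c : ZMod m))
    (fun c => omegaCoeff_add_omegaCoeff_neg a ha c) (α : M)
  rw [← absNorm_span_singleton_eq_prod_sigma hm2 hα0] at h
  have h' := congrArg φ h
  rw [map_mul, ← hconj, Complex.mul_conj, map_pow, map_natCast] at h'
  rw [Complex.sq_norm]
  exact_mod_cast h'

/-- **Weil 1952, §1 (12), for every `r`.** «`ε(a) = J_a((α)) α^{−ω(a)}`. Then, by (8), `ε(a)` is a
unit in `Q(ζ)` … Therefore, by (10), `ε(a)` and all its conjugates have the absolute value `1`. By a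
classical theorem of Kronecker, this implies that `ε(a)` is a root of unity». For `m > 2`, `α ≠ 0`
prime to `m` and `a ∈ (ℤ/m)^{r+1}` with no `a_ρ ≡ 0`: there is a unit `ε` of `𝓞 ℚ(μ_m)` with
`J_a((α)) = ε · α^{ω(a)}`, `|φ(ε)| = 1` for every complex embedding `φ`, and `ε^N = 1` for some
`N ≥ 1` (Kronecker: Mathlib `NumberField.Embeddings.pow_eq_one_of_norm_eq_one`).
[cite: Weil1952JacobiSums, §1 (12), p. 491] -/
theorem exists_unit_jacobiIdealR_eq_mul_galPow (hm2 : 2 < m) {α : 𝓞 M} (hα0 : α ≠ 0)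
    (hα : IsCoprime (Ideal.span {α}) (Ideal.span {(m : 𝓞 M)})) {r : ℕ} (a : Fin (r + 1) → ZMod m)
    (ha : ∀ ρ, a ρ ≠ 0) :
    ∃ ε : (𝓞 M)ˣ,
      (jacobiIdealR a (Ideal.span {α}) : M) =
          (ε : 𝓞 M) * galPow (sigma m M) (fun c => omegaCoeff a (c : ZMod m)) (α : M) ∧
        (∀ φ : M →+* ℂ, ‖φ ((ε : 𝓞 M) : M)‖ = 1) ∧ ∃ N : ℕ, 0 < N ∧ ε ^ N = 1 := by
  have ha' : a ≠ 0 := fun h => ha 0 (congrFun h 0)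
  obtain ⟨ε, hε⟩ := exists_unit_jacobiIdealR_eq hα0 hα a ha'
  have hN0 : (Ideal.absNorm (Ideal.span {α}) : ℝ) ^ (r + 1 + (if ∑ ρ, a ρ = 0 then 0 else 1) - 2) ≠ 0 :=
    pow_ne_zero _ (by
      rw [Nat.cast_ne_zero, Ne, Ideal.absNorm_eq_zero_iff, Ideal.span_singleton_eq_bot]
      exact hα0)
  have hnorm : ∀ φ : M →+* ℂ, ‖φ ((ε : 𝓞 M) : M)‖ = 1 := fun φ => by
    have hJ := norm_map_jacobiIdealR_sq φ (by rwa [Ne, Ideal.span_singleton_eq_bot])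
      (not_mem_of_mem_normalizedFactors_span hα) a ha
    rw [hε, map_mul, norm_mul, mul_pow, norm_map_galPow_omegaCoeff_sq hm2 φ hα0 a ha] at hJ
    have h1 : ‖φ ((ε : 𝓞 M) : M)‖ ^ 2 = 1 :=
      mul_right_cancel₀ hN0 (hJ.trans (one_mul _).symm)
    exact (pow_eq_one_iff_of_nonneg (norm_nonneg _) two_ne_zero).mp h1
  refine ⟨ε, hε, hnorm, ?_⟩
  obtain ⟨N, hN, hεN⟩ := NumberField.Embeddings.pow_eq_one_of_norm_eq_one M ℂ
    (RingOfIntegers.isIntegral_coe (ε : 𝓞 M)) hnorm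
  refine ⟨N, hN, Units.ext ?_⟩
  rw [Units.val_pow_eq_pow_val, Units.val_one, ← RingOfIntegers.eq_iff]
  push_cast
  exact hεN

/-- **«… and hence of the form `±ζ^λ`»** (for odd `m`; Mathlib
`IsPrimitiveRoot.exists_pow_or_neg_mul_pow_of_isOfFinOrder`): for `m > 2` odd, `α ≠ 0` prime to `m`
and `a ∈ (ℤ/m)^{r+1}` with no `a_ρ ≡ 0`, `J_a((α)) = ± ζ^λ · α^{ω(a)}` for some `λ < m`, `ζ = zeta m ℚ M`.
[cite: Weil1952JacobiSums, §1 (12), p. 491] -/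
theorem exists_jacobiIdealR_span_singleton_eq_zeta_pow_mul (hm2 : 2 < m) (hodd : Odd m) {α : 𝓞 M}
    (hα0 : α ≠ 0) (hα : IsCoprime (Ideal.span {α}) (Ideal.span {(m : 𝓞 M)})) {r : ℕ}
    (a : Fin (r + 1) → ZMod m) (ha : ∀ ρ, a ρ ≠ 0) :
    ∃ k : ℕ, k < m ∧
      ((jacobiIdealR a (Ideal.span {α}) : M) =
          zeta m ℚ M ^ k * galPow (sigma m M) (fun c => omegaCoeff a (c : ZMod m)) (α : M) ∨
        (jacobiIdealR a (Ideal.span {α}) : M) =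
          -zeta m ℚ M ^ k * galPow (sigma m M) (fun c => omegaCoeff a (c : ZMod m)) (α : M)) := by
  obtain ⟨ε, hε, -, N, hN, hεN⟩ := exists_unit_jacobiIdealR_eq_mul_galPow hm2 hα0 hα a ha
  have hfin : IsOfFinOrder ((ε : 𝓞 M) : M) := by
    rw [isOfFinOrder_iff_pow_eq_one]
    refine ⟨N, hN, ?_⟩
    have h := congrArg (fun u : (𝓞 M)ˣ => ((u : 𝓞 M) : M)) hεN
    simpa using h
  obtain ⟨k, hk, hk'⟩ := (zeta_spec m ℚ M).exists_pow_or_neg_mul_pow_of_isOfFinOrder hodd hfin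
  refine ⟨k, hk, ?_⟩
  rcases hk' with h | h
  · exact Or.inl (by rw [hε, h])
  · exact Or.inr (by rw [hε, h])

end Principal


/-! ### §7. «±ζ^λ» for EVEN `m`: the roots of unity of `ℚ(μ_m)` are the powers of `ζ_m` -/

section EvenLevel

variable {m : ℕ} [NeZero m] {M : Type*} [Field M] [NumberField M] [hM : IsCyclotomicExtension {m} ℚ M]

/-- **`μ(ℚ(μ_m)) = μ_m` for even `m`**: in an `m`-th cyclotomic extension of `ℚ` with `m` even, every
element of finite order is a power of a primitive `m`-th root of unity `ζ` (for odd `m` one gets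
`±ζ^k`, Mathlib `IsPrimitiveRoot.exists_pow_or_neg_mul_pow_of_isOfFinOrder`). PROOF: an element of
order `l` forces `φ(lcm(l, m)) ≤ [ℚ(μ_m) : ℚ] = φ(m)` (Mathlib `IsPrimitiveRoot.lcm_totient_le_finrank`),
and `lcm(l, m) ∈ {m, 2m}` (`l ∣ 2m`, `IsPrimitiveRoot.dvd_of_isCyclotomicExtension`); for even `m`,
`φ(2m) = 2φ(m) > φ(m)`, so `lcm(l, m) = m`, i.e. `l ∣ m`. (Weil: «of the form `±ζ^λ`»; for even `m`
the sign is `ζ^{m/2}`.) [cite: Weil1952JacobiSums, §1 (12), p. 491 («a root of unity and hence of the form ±ζ^λ»)] -/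
theorem exists_pow_eq_of_isOfFinOrder_of_even (heven : Even m) {ζ x : M} (hζ : IsPrimitiveRoot ζ m)
    (hx : IsOfFinOrder x) : ∃ k : ℕ, k < m ∧ x = ζ ^ k := by
  have hm0 : 0 < m := NeZero.pos m
  have hl0 : 0 < orderOf x := hx.orderOf_pos
  have hxl : IsPrimitiveRoot x (orderOf x) := IsPrimitiveRoot.orderOf x
  -- `φ(lcm(l, m)) ≤ [M : ℚ] = φ(m)`
  have key := IsPrimitiveRoot.lcm_totient_le_finrank hxl hζ
    (Polynomial.cyclotomic.irreducible_rat (Nat.lcm_pos hl0 hm0))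
  rw [IsCyclotomicExtension.finrank M (Polynomial.cyclotomic.irreducible_rat hm0)] at key
  -- `l ∣ 2m`, so `lcm(l, m) = m·r` with `r ∣ 2`
  have hdvd : orderOf x ∣ 2 * m := hxl.dvd_of_isCyclotomicExtension m hl0.ne'
  have hlcm_dvd : Nat.lcm (orderOf x) m ∣ 2 * m := Nat.lcm_dvd hdvd (dvd_mul_left m 2)
  obtain ⟨r, hr⟩ := Nat.dvd_lcm_right (orderOf x) m
  have hr2 : r ∣ 2 := by
    have h2 : m * r ∣ m * 2 := by rw [← hr, mul_comm m 2]; exact hlcm_dvd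
    exact Nat.dvd_of_mul_dvd_mul_left hm0 h2
  have hlcm : Nat.lcm (orderOf x) m = m := by
    rcases (Nat.dvd_prime Nat.prime_two).mp hr2 with h1 | h2
    · rw [hr, h1, mul_one]
    · exfalso
      rw [hr, h2, mul_comm m 2, Nat.totient_two_mul_of_even heven] at key
      have := Nat.totient_pos.mpr hm0
      omega
  have hlm : orderOf x ∣ m := by rw [← hlcm]; exact Nat.dvd_lcm_left _ m
  have hxm : x ^ m = 1 := orderOf_dvd_iff_pow_eq_one.mp hlm
  obtain ⟨k, hk, hkx⟩ := hζ.eq_pow_of_pow_eq_one hxm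
  exact ⟨k, hk, hkx.symm⟩

/-- **Weil (12) «of the form `±ζ^λ`» for EVEN `m`** (the sign absorbed: `−1 = ζ^{m/2}`): for `m > 2` even,
`α ≠ 0` prime to `m` and `a ∈ (ℤ/m)^{r+1}` with no `a_ρ ≡ 0`, `J_a((α)) = ζ^k · α^{ω(a)}` for some
`k < m`, `ζ = zeta m ℚ M` (the odd case `±ζ^k` is `exists_jacobiIdealR_span_singleton_eq_zeta_pow_mul`).
[cite: Weil1952JacobiSums, §1 (12), p. 491] -/
theorem exists_jacobiIdealR_span_singleton_eq_zeta_pow_mul_of_even (hm2 : 2 < m) (heven : Even m)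
    {α : 𝓞 M} (hα0 : α ≠ 0) (hα : IsCoprime (Ideal.span {α}) (Ideal.span {(m : 𝓞 M)})) {r : ℕ}
    (a : Fin (r + 1) → ZMod m) (ha : ∀ ρ, a ρ ≠ 0) :
    ∃ k : ℕ, k < m ∧
      (jacobiIdealR a (Ideal.span {α}) : M) =
        zeta m ℚ M ^ k * galPow (sigma m M) (fun c => omegaCoeff a (c : ZMod m)) (α : M) := by
  obtain ⟨ε, hε, -, N, hN, hεN⟩ := exists_unit_jacobiIdealR_eq_mul_galPow hm2 hα0 hα a ha
  have hfin : IsOfFinOrder ((ε : 𝓞 M) : M) := by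
    rw [isOfFinOrder_iff_pow_eq_one]
    refine ⟨N, hN, ?_⟩
    have h := congrArg (fun u : (𝓞 M)ˣ => ((u : 𝓞 M) : M)) hεN
    simpa using h
  obtain ⟨k, hk, hk'⟩ := exists_pow_eq_of_isOfFinOrder_of_even heven (zeta_spec m ℚ M) hfin
  exact ⟨k, hk, by rw [hε, hk']⟩

/-- **Weil (12) «`ε(a)` … is a root of unity and hence of the form `±ζ^λ`» for EVERY `m > 2`**:
`J_a((α)) = ±ζ^k · α^{ω(a)}` (`k < m`; for even `m` the `+` sign always works, for odd `m` Mathlib's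
`exists_pow_or_neg_mul_pow_of_isOfFinOrder`). [cite: Weil1952JacobiSums, §1 (12), p. 491] -/
theorem exists_jacobiIdealR_span_singleton_eq_zeta_pow_mul' (hm2 : 2 < m) {α : 𝓞 M}
    (hα0 : α ≠ 0) (hα : IsCoprime (Ideal.span {α}) (Ideal.span {(m : 𝓞 M)})) {r : ℕ}
    (a : Fin (r + 1) → ZMod m) (ha : ∀ ρ, a ρ ≠ 0) :
    ∃ k : ℕ, k < m ∧
      ((jacobiIdealR a (Ideal.span {α}) : M) =
          zeta m ℚ M ^ k * galPow (sigma m M) (fun c => omegaCoeff a (c : ZMod m)) (α : M) ∨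
        (jacobiIdealR a (Ideal.span {α}) : M) =
          -zeta m ℚ M ^ k * galPow (sigma m M) (fun c => omegaCoeff a (c : ZMod m)) (α : M)) := by
  rcases Nat.even_or_odd m with heven | hodd
  · obtain ⟨k, hk, h⟩ := exists_jacobiIdealR_span_singleton_eq_zeta_pow_mul_of_even hm2 heven hα0 hα a ha
    exact ⟨k, hk, Or.inl h⟩
  · exact exists_jacobiIdealR_span_singleton_eq_zeta_pow_mul hm2 hodd hα0 hα a ha

end EvenLevel

end Literature.NumberTheory.GaussSums.JacobiSumIdeal

end
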